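import Literature.MathematicalPhysics.QuantumFieldTheory.Balaban1983to89.T4TermwiseClassical

/-!
# T⁴ continuum, node U5 (NE7), TERM-WISE member — THE ONE-STEP DEVIATIONS (U)(L) BEYOND QUADRATIC ORDER: the quartic
# remainder of the Wilson weight, the BCH remainder of the average acting on TRANSPORTED plaquette fields, Jensen and
# its gap for vector-valued fields, and generation 9's binders `dU`, `dL` PRODUCED as explicit geometric majorants
# `C·(L⁻²)^K` from the sizes of one renormalisation step

Lineage t4-ne7-p1 (term-wise matching modulo constants), generation 10.  HONEST FRAMING (page 1): pure YM₄ on a FIXED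
FINITE torus T⁴, rung (B)+1 of the cell's ladder = the `ε → 0` limit of expectations of gauge-invariant observables; NOT
infinite volume, NOT a mass gap, NOT the Clay problem.  Spine estimate NE7 (node U5: for every `K` a `t`-independent
constant `c_K` with `|log Z^B_{K+1}(t) − log Z^A_K(t) − c_K| ≤ δ_K·|T₁|`, `Σ_K δ_K < ∞`) is NOT PRINTED for Bałaban's
d = 4 procedure; its d = 2, 3 template is [King1986] (3.10)–(3.13) pp. 656–657 (TEMPLATE ONLY).  Every estimate below is
a HYPOTHESIS BINDER named in the statement; nothing of Bałaban's expansions is asserted; no conditional is hidden — the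
flow window (0.31) of [Balaban1987RG1] (the cell's BetaPertH road; tree `Step.Discrete031`) enters BY NAME as the binders
`h031A`/`h031B` of §5's capstone exactly as in generations 7–9, and (B), (B^μ) sit by name inside the producers of the
other binders exactly where those modules declare them.  All declarations are [folklore] bookkeeping (finite sums,
Cauchy–Schwarz, the polarisation identity of a real inner-product space, two Taylor inequalities for the cosine,
monotonicity of products of non-negative reals, the geometric series).  NO definitions, no cite tags.

## Why this leaf (record `t4/T4-EST-NE7-P1.md` v9 §13 (13d)(v): after generation 9 the first genuine proof target of
## the term-wise route is (U)/(L) BEYOND QUADRATIC ORDER — generation 9's own "What is NOT delivered": «the passage from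
## Bałaban's nonabelian average … and the Wilson action to §2's quadratic model with a controlled remainder … NOT
## PRINTED as an inequality for (U)(L) and not proved here»)
Generation 9 (`T4TermwiseClassical`) read the one-run one-step action deviation as ONE CLASSICAL RENORMALISATION STEP,
split it BY ORDER ALONE into the interpolation error (U) of a lift and the averaging error (L) at run B's minimiser,
PROVED both at QUADRATIC ORDER for SCALAR plaquette fields (Jensen `coarse ≤ rc·fine`; the gap `rc·fine − coarse ≤
r²·Σ_y osc_y²`), and left (U) `≤ vol·dU_K`, (L) `≤ vol·dL_K`, `0 ≤ dU, dL`, `Σ dU, Σ dL < ∞` as the six binders `hUdev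
hLdev hdU0 hdL0 hdU hdL`.  Two remainders separate that quadratic scalar model from the Wilson action and Bałaban's
average, and this leaf carries both:
(W) THE WEIGHT.  The Wilson plaquette weight is not quadratic: for U(1), `e(θ) = 1 − cos θ`; for SU(2) in exponential
  coordinates `U(∂p) = exp v`, `v ∈ su(2) ≅ ℝ³` normed by the rotation angle, `e(v) = 1 − ½ tr U(∂p) = 1 − cos‖v‖`; for
  SU(N), `e(X) = 1 − (1/N) Re tr e^X = (1/N)·Σ_j (1 − cos θ_j)` over the eigenvalue angles, with `‖X‖² = (1/N)·Σ_j θ_j²`.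
  §1 PROVES the QUARTIC SANDWICH `‖v‖²/2 − ‖v‖⁴/24 ≤ 1 − cos‖v‖ ≤ ‖v‖²/2` on any real normed space
  (`one_sub_cos_norm_sandwich`; from Mathlib's `Real.one_sub_sq_div_two_le_cos` and the tree's kernel-proved [folklore]
  `Literature.Probability.LatticeModels.cos_le_one_sub_sq_half_add_fourth`, imported through generation 9 and used BY
  NAME) — so the weight binder (wt) `‖v‖²/2 − q₄‖v‖⁴ ≤ e v ≤ ‖v‖²/2` below is DISCHARGED in the kernel for U(1) and, up to
  the class-angle identification just displayed, for SU(2) (`q₄ = 1/24`); for SU(N) it holds with `q₄ = N/24` by the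
  eigenvalue formula and `Σ_j θ_j⁴ ≤ (Σ_j θ_j²)²` (arithmetic recorded here, not formalised: `e`, `q₄` are PARAMETERS).
(A) THE AVERAGE.  Bałaban's one-step average ([Balaban1985Averaging] (14)–(15) p. 19: block averages of bond variables
  parallel-transported along contours `Γ_{y,x}`) is not linear.  Its LINEARISATION on plaquette variables is the EXACT
  NON-NEGATIVE KERNEL of generation 9: in the abelian case with translation-covariant contours the contour contributions
  of the four averaged sides of a big plaquette `p′ = (y; μν)` CANCEL, and with the linear average of
  [Balaban1984PropagatorsI] (1.11) p. 19 «(QA)_c = Σ_{x∈B(c₋)} L^{−(d+1)} A([x, x(c)])» (quoted in the tree's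
  `B7BlockGeometry`) the coarse plaquette variable in lattice units is `ψ(p′) = L^{−d}·Σ_{x∈B(y)} Σ_{p ⊂ □^{μν}_L(x)} φ(p)`:
  the kernel `w(p′,p) = L^{−d}·#{x ∈ B(y) : p ⊂ □^{μν}_L(x)} ≥ 0` has row sums `L^{−d}·L^d·L² = L²` (the leading
  coefficient of [Balaban1985Averaging] Prop. 1 (51) p. 26 «|V̄(∂p′) − 1| < L²α₀ + C₀(L²α₀)²», tree `B7.Prop1Printed`) and
  column sums `L^{−d}·L² = L^{2−d}` for EVERY fine plaquette (each lies in exactly `L²` squares `□_L(x)`, each `x` in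
  exactly one block): `rc = L^{4−d} = 1` in d = 4 — a counting identity recorded here, NOT PRINTED; in the module `r = L²`,
  `c = L⁻²` are the HYPOTHESES (ker).  In the nonabelian case the linear term is the same sum with the fine plaquette
  variables TRANSPORTED to the frame of `p′` by the adjoint action of the transporters — ISOMETRIES of `V`, whence the
  binder (tr) `‖Φ y x‖ = ‖φ x‖` on an otherwise arbitrary `Φ` — and the true coarse plaquette variable differs from it by
  the commutator (BCH) REMAINDER of second order, the `C₀(L²α₀)²` of (51) (mechanism: (28)–(38) pp. 22–23 ibid., tree
  `B7Eq38Remainder.eq38_printed`): the binder (bch) `‖ψ y − Σ_x w(y,x)•Φ y x‖ ≤ ρ(y)` — LOCATED as to size and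
  mechanism, NOT PRINTED as this inequality.
WHAT §2 PROVES, for fields with values in a real inner-product space `V`: JENSEN for transported fields
(`blockedQuadratic_norm_le`: `Σ_y ‖Σ_x w•Φ y x‖² ≤ rc·Σ_x ‖φ x‖²`, the triangle inequality onto generation 9's scalar
`blockedQuadratic_le` BY NAME); the PAIRWISE FORM of the weighted variance (`weightedPairwise_eq`:
`Σ_{x,x′} w_x w_{x′} ‖f_x − f_{x′}‖² = 2·((Σw)·Σ_x w_x‖f_x‖² − ‖Σ_x w_x•f_x‖²)`, polarisation); the block gap (`blockGap_le`:
`r·Σ w‖f‖² − ‖Σ w•f‖² ≤ r²δ²/2`) and the whole-kernel gap (`jensenGap_norm_le`: `rc·Σ‖φ‖² − Σ_y ‖Σ_x w•Φ‖² ≤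
(r²/2)·Σ_y osc_y²` — generation 9's constant `r²` halved, vector-valued).  §2b ADDS THE TWO REMAINDERS: `averagingError_le`
— (L) `Σ_y e(ψ y) − Σ_x e(φ x) ≤ (rc − 1)/2·Σ‖φ‖² + Σ_y (‖Σ_x w•Φ‖·ρ_y + ρ_y²/2) + q₄·Σ_x ‖φ x‖⁴`; `interpolationError_le` —
(U) `Σ_x e(φ x) − Σ_y e(ψ y) ≤ (1 − rc)/2·Σ‖φ‖² + (r²/4)·Σ_y osc_y² + Σ_y ‖Σ_x w•Φ‖·ρ_y + q₄·Σ_y ‖ψ y‖⁴`.  With `rc = 1` the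
quadratic parts CANCEL (the classical scale invariance of d = 4: the functional (5) of [Balaban1985Variational], «A(U) =
Σ_{p⊂Ω₀} η^{d−4}[1 − Re tr U(∂p)]», carries `η^{d−4} = 1`, so run A's and run B's weight-free actions are the SAME
plaquette sum `Σ_p e(·)` on their own lattices — the binders (repr) below), and what is left is the BCH cross term
`‖Σ w•Φ‖·ρ`, `ρ²/2`, the quartic weight remainder and, for (U), the window variance.
THE RATE (§3–§4).  In SIZES — fields `‖φ‖ ≤ s`, window oscillation `≤ ω`, BCH remainder `≤ ρb`, counts `#P ≤ Nf`,
`#P′ ≤ Nc` — (L) `≤ Nc·(r·s·ρb + ρb²/2) + q₄·Nf·s⁴` and (U) `≤ Nc·(r²ω²/4 + r·s·ρb + q₄·(r·s + ρb)⁴)`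
(`averagingError_le_of_sizes`, `interpolationError_le_of_sizes`).  At SCALE `a = L^{−K}` (run A's spacing; run B's
`b = L^{−(K+1)}`, `r·b² = a²`), with `s ≤ c₁ε₁b²` (plaquette variables of a field of strength `O(ε₁)` at unit scale),
`ω ≤ c₂ε₁b²a` (a plaquette field LIPSCHITZ at unit scale, over an averaging window of `O(L)` fine steps), `ρb ≤ c₃ε₁²a⁴`
((51)'s second-order term with `α₀ = s`), `Nf·b⁴, Nc·a⁴ ≤ n₀·vol` (`n₀ = d(d−1)/2 = 6` plaquettes per site), EVERY term
carries at least `a²`: (L) `≤ vol·n₀·(c₁c₃ε₁³ + c₃²ε₁⁴/2 + q₄c₁⁴ε₁⁴)·a²`, (U) `≤ vol·n₀·(c₂²ε₁²/4 + c₁c₃ε₁³ +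
q₄(c₁ε₁ + c₃ε₁²)⁴)·a²` (`averagingSize_le_scale`, `interpolationSize_le_scale`); `a² = (L⁻²)^K` is the GEOMETRIC FACTOR
`ξ = L⁻²` of generation 9's counting, here a theorem of the stated sizes, summable for `1 < L`
(`geometricRate_nonneg_summable`).  The technique's sentence — bound `δ_K` from the rates composed along the tower and show
summability from the geometric factors — is, for the action kind, §5.

## What this module adds (additive leaf; imports `T4TermwiseClassical` (generation 9) BY NAME; nothing upstream edited)
§1 `one_sub_cos_sandwich`, `one_sub_cos_sandwich_norm`, `one_sub_cos_norm_sandwich` — the quartic sandwich of the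
   Wilson weight (U(1); `1 − cos‖v‖` on any real normed space).
§2 `weightedPairwise_eq`, `blockGap_le`, `blockedQuadratic_norm_le`, `jensenGap_norm_le` (vector-valued, transported).
§2b `sq_sub_two_mul_le_sq`, `averagingError_le` (L), `interpolationError_le` (U) — with the BCH binder `hρ` and the
   weight binder `he`.
§3 `norm_blockAverage_le`, `averagingError_le_of_sizes`, `interpolationError_le_of_sizes`.
§4 `averagingSize_le_scale`, `interpolationSize_le_scale`, `scale_facts`, `geometricRate_nonneg_summable`.
§5 `count_mul_inv_pow_le`; `interpolation_averaging_of_regular` — the indexed PRODUCER of generation 9's six binders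
   (U) `hUdev hdU0 hdU`, (L) `hLdev hdL0 hdL` with the EXPLICIT majorants `dU_K = n₀·(c₂²ε₁²/4 + c₁c₃ε₁³ + q₄(c₁ε₁ +
   c₃ε₁²)⁴)·(L⁻²)^K`, `dL_K = n₀·(c₁c₃ε₁³ + c₃²ε₁⁴/2 + q₄c₁⁴ε₁⁴)·(L⁻²)^K`; `goodClause_summable_of_kindsRA_regular` —
   generation 9's `goodClause_summable_of_kindsRA_lift` with those six binders REPLACED by the producer's and `dU_K +
   dL_K` SPELLED OUT inside `δ⁗`.  Generation 8's end-to-end theorem `hasContinuumLimit_of_kindsRA_nodesT` takes (R-act) per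
   string as `haR hrα`, which generation 9's `actionRadius_of_lift` supplies from (U)(L) — no new end-to-end theorem is
   needed and none is added.
§6 `toy_wilsonWeight` ((wt) inhabited by `1 − cos` with `q₄ = 1/24`, and not by its quadratic part: `1 − cos π = 2 ≠
   π²/2`); `toy_bchCrossTerm_attained` (one fine and one coarse plaquette, `ψ = Σ w•Φ + ρ` with `ρ = 1`: the averaging
   error (L) `= 3/2 ≠ 0` EQUALS `averagingError_le`'s bound — the BCH cross term is sharp).  No physics.

## Binder census of `goodClause_summable_of_kindsRA_regular` (every one a hypothesis; which are estimates)
As generation 9's `goodClause_summable_of_kindsRA_lift` (its census unchanged: (T)(B-T)(R-T)(F)(F′)(S)(M)(M-B)(B-adm)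
(B-win)(N)(Q)(R-sc)(M-R)(R-S)(0.31)(min-A)(Q)(lift)(min-B)(act)(γ)(R-w)(W-w); read (min-A)/(min-B)'s fibres as the
SMALL-FIELD spaces (8) `𝔘_k({Ω_j}, B₃ε₁) ∩ 𝔅_k(𝔅_k, V)` of [Balaban1985Variational] Theorem 1, the existence of run A's
background being clause (8) itself), with (U) `hUdev hdU0 hdU` and (L) `hLdev hdL0 hdL` REPLACED by:
(wt) `he hq₄` — the weight's quartic sandwich (DISCHARGED by §1 for U(1), and for SU(2) up to `e = 1 − cos‖·‖`; a
  hypothesis on the parameter `e : V → ℝ`);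
(ker) `hL hw hrow hcol` — `1 < L`; the linearised average is a non-negative kernel `w_K` from the fine plaquettes `Pf K`
  to the coarse ones `Pc K` with row sums `L²` and column sums `L⁻²` (the abelian counting identity of (A); NOT PRINTED; a
  hypothesis on the abstract `w`);
(cnt) `hn₀ hNf hNc` — `#Pf K ≤ n₀·vol·L^{4(K+1)}`, `#Pc K ≤ n₀·vol·L^{4K}` (lattice geometry; hypotheses);
(repr-U)/(repr-L) `hreprU hreprL` — run B's weight-free action at the lift `yA`, resp. at its own background `yB`, and
  run A's at `xA`, resp. at the one-step average `Q yB`, ARE the plaquette sums `Σ_p e(·)` of plaquette fields `φA, ψA`,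
  resp. `φB, ψB` (functional (5) of [Balaban1985Variational] with `η^{d−4} = 1`; (2.2)–(2.3) p. 265 of [Balaban1987RG1],
  «V^{(k)} = Ū^k_{k+1} = M^k(U_{k+1})», `M` the one-step average (14)–(15) p. 19 of [Balaban1985Averaging], its iterate
  `M^k` (1.1) p. 260 / (2.3) p. 265 of [Balaban1987RG1]; definitional in print, a HYPOTHESIS here because `f₁`, `g`, `Q`
  are abstract);
(tr-U)/(tr-L) `hΦA hΦB` — transport to the coarse frame is an isometry: `‖ΦA y x‖ = ‖φA x‖` (exact for the adjoint
  action; a hypothesis on the abstract `Φ`);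
(bch-U)/(bch-L) `hρA hρB` — the coarse plaquette field of the one-step average equals the kernel average of the
  transported fine field up to `ρb_K` (for (U): `ψA` is the field of `xA = Q yA`, (lift)) (LOCATED: (51) p. 26, the
  second-order term `C₀(L²α₀)²`, mechanism (28)–(38) pp. 22–23; NOT PRINTED as this inequality; ESTIMATE);
(sz-U)/(sz-L) `hsA hsB` — plaquette fields of size `≤ s_K` (LOCATED in shape: conditions (2) of [Balaban1985Variational],
  «|U(∂p) − 1| < ε₀η²(L^jη)^{−2} for p ∈ Ω_j», at the top scale `L^jη = 1` with `ε₀ = B₃ε₁`, `η = η_{K+1} = L^{−(K+1)}`, for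
  run B's background `yB ∈ 𝔘_{K+1}({Ω_j}, B₃ε₁)` (clause (8)); for the lift `yA` read as the one-step minimiser over the
  datum `xA` — Theorem 1 at k = 1, whose hypothesis (7) «|(∂V)(p′) − 1| < ε₁» is supplied with `ε₁ ↦ B₃ε₁η_K²` by run A's
  own condition (2) at ITS top scale, and whose auxiliary background of Sect. A (14) is, p. 280, «for k = 1 … we take
  simply U₀ = V₀» — the same (2) at `j = k = 1` gives `B₃²ε₁η_{K+1}²`; NOT instantiated: hypotheses, ESTIMATES);
(osc-U) `hoscA` — the lift's transported plaquette field oscillates by `≤ ω_K` over every averaging window (NOT PRINTED: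
  Theorem 1 at k = 1 measures the datum `xA` only through its sup-size at scale `a = η_K` and its Hölder clause (9),
  «‖A‖_{1,β} < B₄(β₀)Mε₁(L^jη)^{−2−β} for 0 ≤ β ≤ β₀ = 1», then returns a unit-WINDOW Lipschitz constant WITHOUT the extra
  factor `a`; the unit-SCALE smoothness of `xA` ((9)–(10) at level `K`) must propagate to its one-step lift — a two-level
  regularity statement absent from print.  THIS IS THE BINDER THAT CARRIES THE RATE OF (U); ESTIMATE);
(scal) `hc₁ hc₃ hε₁ hs hω hρb` — the size laws `0 ≤ s_K ≤ c₁ε₁L^{−2(K+1)}`, `0 ≤ ω_K ≤ c₂ε₁L^{−2(K+1)}L^{−K}`, `0 ≤ ρb_K ≤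
  c₃ε₁²L^{−4K}` (shapes as just located; NOT PRINTED as laws uniform in `K`; ESTIMATES).
OUTPUT: the good clause with `δ⁗_K` explicit — its action-kind share is `w₀·(dU_K + dL_K)` with the displayed geometric
`dU`, `dL` — and `Summable δ⁗`.

## What is NOT delivered
Any instantiation of (ker)(tr)(bch)(sz)(osc)(scal) on Bałaban's configurations: the kernel `w` and the transport `Φ` are
not constructed from (14)–(15); (bch) is not derived from (38); (osc-U) is not derived from anything in print; the SU(N),
N ≥ 3, weight sandwich is not formalised; the verification that `xA` meets (7) of the one-step problem; any producer of
(act), (γ), (R-w), (W-w) or of generation 8's binder families; anything about print.  NOT re-opened (record (13d)(vi)):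
the two-sided (δ-S); exact piecewise-constant lifts with `dU = 0` ((U) is a variance); the E-, boundary-, 𝐑-rate
families, pv16's good-class datum, (γ), (R-w), (W-w) — consumed BY NAME exactly as generation 9 consumes them; the
representation (act) `a = w₀·S + γ` is kept.

References (LOCATIONS / TEMPLATE only; nothing here is cited as proving a binder): [King1986] C. King, The U(1) Higgs
model: I. The continuum limit, Commun. Math. Phys. 102 (1986) 649–677, (3.10)–(3.13) pp. 656–657; [Balaban1987RG1]
T. Bałaban, Renormalization group approach to lattice gauge field theories. I, Commun. Math. Phys. 109 (1987) 249–301,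
(0.31) p. 259, (1.1) p. 260, (2.1)–(2.3) p. 265; [Balaban1985Averaging] T. Bałaban, Averaging operations for lattice gauge
theories, Commun. Math. Phys. 98 (1985) 17–51, (14)–(15) p. 19, (28)–(38) pp. 22–23, Prop. 1 (51) p. 26;
[Balaban1984PropagatorsI] T. Bałaban, Propagators and renormalization transformations for lattice gauge theories. I,
Commun. Math. Phys. 95 (1984) 17–40, (1.8), (1.11) p. 19; [Balaban1985Variational] T. Bałaban, The variational problem and
background fields in renormalization group method for lattice gauge theories, Commun. Math. Phys. 102 (1985) 277–309,
conditions (2), functional (5), Theorem 1 (7)–(10) p. 279, Sect. A (11)–(14) pp. 279–280.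
-/

open Finset MeasureTheory _root_.Filter _root_.Topology
open scoped RealInnerProductSpace

namespace Literature.MathematicalPhysics.QuantumFieldTheory.Balaban1983to89.T4TermwiseQuartic

open T4OutputRate T4RecentScale T4GoodClassBudget T4CauchySum T4Crossover T4TowerRateComposition T4TowerRateDischarge
open T4BoundaryCarrier (BFunctional atFl NE9Fl LipBackgroundFl NE5B)
open T4CurrencyMatching (invSq couplingRateT_of_injectedDisc)
open T4TermwiseBudget T4TermwiseDeviation T4TermwiseCurrency T4TermwiseBoundary T4TermwiseResidual T4TermwiseAction
open T4TermwiseClassical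

/-! ## §1 The single-plaquette Taylor sandwich of the Wilson weight -/

/-- `x²/2 − x⁴/24 ≤ 1 − cos x ≤ x²/2`. [folklore] -/
theorem one_sub_cos_sandwich (x : ℝ) :
    x ^ 2 / 2 - 1 / 24 * x ^ 4 ≤ 1 - Real.cos x ∧ 1 - Real.cos x ≤ x ^ 2 / 2 := by
  constructor
  · linarith [Literature.Probability.LatticeModels.cos_le_one_sub_sq_half_add_fourth x]
  · linarith [Real.one_sub_sq_div_two_le_cos (x := x)]

/-- The same in the norm of `ℝ` (the shape of the binder (wt) below with `q = 1/24`). [folklore] -/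
theorem one_sub_cos_sandwich_norm (x : ℝ) :
    ‖x‖ ^ 2 / 2 - 1 / 24 * ‖x‖ ^ 4 ≤ 1 - Real.cos x ∧ 1 - Real.cos x ≤ ‖x‖ ^ 2 / 2 := by
  have e2 : ‖x‖ ^ 2 = x ^ 2 := by rw [Real.norm_eq_abs, sq_abs]
  have e4 : ‖x‖ ^ 4 = x ^ 4 := by
    rw [show (4 : ℕ) = 2 * 2 from rfl, pow_mul, e2, ← pow_mul]
  rw [e2, e4]
  exact one_sub_cos_sandwich x

/-- The SU(2)-shaped weight `v ↦ 1 − cos‖v‖` on any real normed space satisfies the quartic sandwich with `q₄ = 1/24`: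
`‖v‖²/2 − ‖v‖⁴/24 ≤ 1 − cos‖v‖ ≤ ‖v‖²/2`. [folklore] -/
theorem one_sub_cos_norm_sandwich {V : Type*} [NormedAddCommGroup V] (v : V) :
    ‖v‖ ^ 2 / 2 - 1 / 24 * ‖v‖ ^ 4 ≤ 1 - Real.cos ‖v‖ ∧ 1 - Real.cos ‖v‖ ≤ ‖v‖ ^ 2 / 2 :=
  one_sub_cos_sandwich ‖v‖

/-! ## §2 The averaging kernel on transported vector-valued plaquette fields -/

section Kernel

variable {V : Type*} [NormedAddCommGroup V] [InnerProductSpace ℝ V] {X Y : Type*}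

/-- **THE PAIRWISE FORM OF THE WEIGHTED VARIANCE** (one block).  For weights `w` and a field `f` with values in a
real inner-product space: `Σ_x Σ_x' w_x w_x' ‖f_x − f_x'‖² = 2·((Σ w)·Σ_x w_x‖f_x‖² − ‖Σ_x w_x•f_x‖²)`. [folklore] -/
theorem weightedPairwise_eq (P : Finset X) (w : X → ℝ) (f : X → V) :
    ∑ x ∈ P, ∑ x' ∈ P, w x * w x' * ‖f x - f x'‖ ^ 2
      = 2 * ((∑ x ∈ P, w x) * ∑ x ∈ P, w x * ‖f x‖ ^ 2 - ‖∑ x ∈ P, w x • f x‖ ^ 2) := by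
  have hS : ‖∑ x ∈ P, w x • f x‖ ^ 2 = ∑ x ∈ P, ∑ x' ∈ P, w x * w x' * ⟪f x, f x'⟫ := by
    rw [← real_inner_self_eq_norm_sq, sum_inner]
    refine Finset.sum_congr rfl fun x _ => ?_
    rw [inner_sum]
    refine Finset.sum_congr rfl fun x' _ => ?_
    rw [real_inner_smul_left, real_inner_smul_right]
    ring
  have h1 : ∑ x ∈ P, ∑ x' ∈ P, w x * w x' * ‖f x‖ ^ 2 = (∑ x ∈ P, w x) * ∑ x ∈ P, w x * ‖f x‖ ^ 2 := by
    have e : ∀ x, ∑ x' ∈ P, w x * w x' * ‖f x‖ ^ 2 = (w x * ‖f x‖ ^ 2) * ∑ x' ∈ P, w x' := by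
      intro x
      rw [Finset.mul_sum]
      exact Finset.sum_congr rfl fun x' _ => by ring
    simp_rw [e]
    rw [← Finset.sum_mul, mul_comm]
  have h2 : ∑ x ∈ P, ∑ x' ∈ P, w x * w x' * ‖f x'‖ ^ 2 = (∑ x ∈ P, w x) * ∑ x ∈ P, w x * ‖f x‖ ^ 2 := by
    have e : ∀ x, ∑ x' ∈ P, w x * w x' * ‖f x'‖ ^ 2 = w x * ∑ x' ∈ P, w x' * ‖f x'‖ ^ 2 := by
      intro x
      rw [Finset.mul_sum]
      exact Finset.sum_congr rfl fun x' _ => by ring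
    simp_rw [e]
    rw [← Finset.sum_mul]
  have h3 : ∑ x ∈ P, ∑ x' ∈ P, 2 * (w x * w x' * ⟪f x, f x'⟫)
      = 2 * ∑ x ∈ P, ∑ x' ∈ P, w x * w x' * ⟪f x, f x'⟫ := by
    rw [Finset.mul_sum]
    exact Finset.sum_congr rfl fun x _ => by rw [Finset.mul_sum]
  calc ∑ x ∈ P, ∑ x' ∈ P, w x * w x' * ‖f x - f x'‖ ^ 2
      = ∑ x ∈ P, ∑ x' ∈ P, (w x * w x' * ‖f x‖ ^ 2 + w x * w x' * ‖f x'‖ ^ 2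
          - 2 * (w x * w x' * ⟪f x, f x'⟫)) := by
        refine Finset.sum_congr rfl fun x _ => Finset.sum_congr rfl fun x' _ => ?_
        rw [norm_sub_sq_real]
        ring
    _ = (∑ x ∈ P, ∑ x' ∈ P, w x * w x' * ‖f x‖ ^ 2 + ∑ x ∈ P, ∑ x' ∈ P, w x * w x' * ‖f x'‖ ^ 2)
          - ∑ x ∈ P, ∑ x' ∈ P, 2 * (w x * w x' * ⟪f x, f x'⟫) := by
        simp only [Finset.sum_sub_distrib, Finset.sum_add_distrib]
    _ = 2 * ((∑ x ∈ P, w x) * ∑ x ∈ P, w x * ‖f x‖ ^ 2 - ‖∑ x ∈ P, w x • f x‖ ^ 2) := by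
        rw [h1, h2, h3, hS]
        ring

/-- **THE GAP BOUND IN ONE BLOCK (vector-valued).**  Non-negative weights with `Σ w = r` and a field oscillating by at
most `δ` (in norm) over the support of `w`: `r·Σ w‖f‖² − ‖Σ w•f‖² ≤ r²·δ²/2`. [folklore] -/
theorem blockGap_le (P : Finset X) {w : X → ℝ} {f : X → V} {r δ : ℝ} (hw : ∀ x ∈ P, 0 ≤ w x)
    (hrow : ∑ x ∈ P, w x = r)
    (hosc : ∀ x ∈ P, ∀ x' ∈ P, 0 < w x → 0 < w x' → ‖f x - f x'‖ ≤ δ) :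
    r * ∑ x ∈ P, w x * ‖f x‖ ^ 2 - ‖∑ x ∈ P, w x • f x‖ ^ 2 ≤ r ^ 2 * δ ^ 2 / 2 := by
  have hpair := weightedPairwise_eq P w f
  rw [hrow] at hpair
  have key : ∑ x ∈ P, ∑ x' ∈ P, w x * w x' * ‖f x - f x'‖ ^ 2 ≤ ∑ x ∈ P, ∑ x' ∈ P, w x * w x' * δ ^ 2 := by
    refine Finset.sum_le_sum fun x hx => Finset.sum_le_sum fun x' hx' => ?_
    have hww : 0 ≤ w x * w x' := mul_nonneg (hw x hx) (hw x' hx')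
    rcases (hw x hx).eq_or_lt with h0 | hpos
    · rw [← h0]; simp
    rcases (hw x' hx').eq_or_lt with h0' | hpos'
    · rw [← h0']; simp
    have h := hosc x hx x' hx' hpos hpos'
    exact mul_le_mul_of_nonneg_left (pow_le_pow_left₀ (norm_nonneg _) h 2) hww
  have e : ∑ x ∈ P, ∑ x' ∈ P, w x * w x' * δ ^ 2 = r ^ 2 * δ ^ 2 := by
    have e1 : ∀ x, ∑ x' ∈ P, w x * w x' * δ ^ 2 = w x * δ ^ 2 * ∑ x' ∈ P, w x' := by
      intro x
      rw [Finset.mul_sum]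
      exact Finset.sum_congr rfl fun x' _ => by ring
    simp_rw [e1, hrow]
    rw [← Finset.sum_mul, ← Finset.sum_mul, hrow]
    ring
  rw [hpair] at key
  linarith

/-- **JENSEN FOR TRANSPORTED FIELDS.**  A non-negative kernel `w(y,x)` with row sums `≤ r` (`0 ≤ r`) and column sums
`≤ c`, and for each coarse plaquette `y` the fine plaquette variables TRANSPORTED to `y`'s frame, `Φ y x`, with
`‖Φ y x‖ = ‖φ x‖`: `Σ_y ‖Σ_x w(y,x)•Φ y x‖² ≤ r·c·Σ_x ‖φ x‖²`. [folklore] -/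
theorem blockedQuadratic_norm_le (P : Finset X) (P' : Finset Y) {w : Y → X → ℝ} {Φ : Y → X → V} {φ : X → V}
    {r c : ℝ} (hw : ∀ y ∈ P', ∀ x ∈ P, 0 ≤ w y x) (hr : 0 ≤ r) (hrow : ∀ y ∈ P', ∑ x ∈ P, w y x ≤ r)
    (hcol : ∀ x ∈ P, ∑ y ∈ P', w y x ≤ c) (hΦ : ∀ y ∈ P', ∀ x ∈ P, ‖Φ y x‖ = ‖φ x‖) :
    ∑ y ∈ P', ‖∑ x ∈ P, w y x • Φ y x‖ ^ 2 ≤ r * c * ∑ x ∈ P, ‖φ x‖ ^ 2 := by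
  have h1 : ∀ y ∈ P', ‖∑ x ∈ P, w y x • Φ y x‖ ^ 2 ≤ (∑ x ∈ P, w y x * ‖φ x‖) ^ 2 := by
    intro y hy
    refine pow_le_pow_left₀ (norm_nonneg _) ?_ 2
    refine (norm_sum_le _ _).trans (le_of_eq ?_)
    refine Finset.sum_congr rfl fun x hx => ?_
    rw [norm_smul, Real.norm_eq_abs, abs_of_nonneg (hw y hy x hx), hΦ y hy x hx]
  calc ∑ y ∈ P', ‖∑ x ∈ P, w y x • Φ y x‖ ^ 2 ≤ ∑ y ∈ P', (∑ x ∈ P, w y x * ‖φ x‖) ^ 2 :=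
        Finset.sum_le_sum h1
    _ ≤ r * c * ∑ x ∈ P, ‖φ x‖ ^ 2 := blockedQuadratic_le P P' hw hr hrow hcol

/-- **THE JENSEN GAP OF THE WHOLE KERNEL (transported, vector-valued).**  Exact normalisation (row sums `= r`, column
sums `= c`), non-negative weights, `‖Φ y x‖ = ‖φ x‖`, and the transported field oscillating by at most `osc(y)` over the
window of `y`: `r·c·Σ_x ‖φ x‖² − Σ_y ‖Σ_x w•Φ y x‖² ≤ (r²/2)·Σ_y osc(y)²`. [folklore] -/
theorem jensenGap_norm_le (P : Finset X) (P' : Finset Y) {w : Y → X → ℝ} {Φ : Y → X → V} {φ : X → V}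
    {r c : ℝ} {osc : Y → ℝ} (hw : ∀ y ∈ P', ∀ x ∈ P, 0 ≤ w y x) (hrow : ∀ y ∈ P', ∑ x ∈ P, w y x = r)
    (hcol : ∀ x ∈ P, ∑ y ∈ P', w y x = c) (hΦ : ∀ y ∈ P', ∀ x ∈ P, ‖Φ y x‖ = ‖φ x‖)
    (hosc : ∀ y ∈ P', ∀ x ∈ P, ∀ x' ∈ P, 0 < w y x → 0 < w y x' → ‖Φ y x - Φ y x'‖ ≤ osc y) :
    r * c * ∑ x ∈ P, ‖φ x‖ ^ 2 - ∑ y ∈ P', ‖∑ x ∈ P, w y x • Φ y x‖ ^ 2 ≤ r ^ 2 / 2 * ∑ y ∈ P', osc y ^ 2 := by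
  have e : ∑ y ∈ P', r * ∑ x ∈ P, w y x * ‖Φ y x‖ ^ 2 = r * c * ∑ x ∈ P, ‖φ x‖ ^ 2 := by
    have e0 : ∀ y ∈ P', ∑ x ∈ P, w y x * ‖Φ y x‖ ^ 2 = ∑ x ∈ P, w y x * ‖φ x‖ ^ 2 :=
      fun y hy => Finset.sum_congr rfl fun x hx => by rw [hΦ y hy x hx]
    rw [Finset.sum_congr rfl fun y hy => by rw [e0 y hy], ← Finset.mul_sum, Finset.sum_comm, mul_assoc]
    congr 1
    rw [Finset.mul_sum]
    refine Finset.sum_congr rfl fun x hx => ?_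
    rw [← Finset.sum_mul, hcol x hx]
  calc r * c * ∑ x ∈ P, ‖φ x‖ ^ 2 - ∑ y ∈ P', ‖∑ x ∈ P, w y x • Φ y x‖ ^ 2
      = ∑ y ∈ P', (r * ∑ x ∈ P, w y x * ‖Φ y x‖ ^ 2 - ‖∑ x ∈ P, w y x • Φ y x‖ ^ 2) := by
        rw [← e, Finset.sum_sub_distrib]
    _ ≤ ∑ y ∈ P', r ^ 2 * osc y ^ 2 / 2 :=
        Finset.sum_le_sum fun y hy => blockGap_le P (hw y hy) (hrow y hy) (hosc y hy)
    _ = r ^ 2 / 2 * ∑ y ∈ P', osc y ^ 2 := by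
        rw [Finset.mul_sum]
        exact Finset.sum_congr rfl fun y _ => by ring

end Kernel

/-! ## §2b The one-step deviations (U) and (L) BEYOND quadratic order: quartic weight remainder and the BCH remainder -/

section Deviation

variable {V : Type*} [NormedAddCommGroup V] [InnerProductSpace ℝ V] {X Y : Type*}

/-- `0 ≤ a ≤ b + ρ`, `0 ≤ b` give `a² − 2aρ ≤ b²` (two cases on `a ≤ 2ρ`). [folklore] -/
theorem sq_sub_two_mul_le_sq {a b ρ : ℝ} (ha : 0 ≤ a) (hb : 0 ≤ b) (h : a ≤ b + ρ) :
    a ^ 2 - 2 * (a * ρ) ≤ b ^ 2 := by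
  rcases le_or_gt a (2 * ρ) with h2 | h2
  · nlinarith [sq_nonneg b, mul_nonneg ha (sub_nonneg.2 h2)]
  · have hpos : 0 ≤ a - ρ := by
      rcases le_or_gt 0 ρ with hρ | hρ <;> linarith
    have hle : a - ρ ≤ b := by linarith
    nlinarith [mul_le_mul hle hle hpos hb, sq_nonneg ρ]

/-- **THE AVERAGING ERROR (L) WITH REMAINDERS.**  Weight `e` with the quartic sandwich `‖v‖²/2 − q‖v‖⁴ ≤ e v ≤ ‖v‖²/2`;
a non-negative kernel with row sums `≤ r`, column sums `≤ c`; transported fine field `Φ` (`‖Φ y x‖ = ‖φ x‖`); the coarse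
field `ψ` equal to the kernel average of the transported fine field UP TO `ρ(y)` (the BCH remainder, binder `hρ`).  Then
`Σ_y e(ψ y) − Σ_x e(φ x) ≤ (rc − 1)/2·Σ‖φ‖² + Σ_y (‖Σ_x w•Φ‖·ρ_y + ρ_y²/2) + q·Σ_x ‖φ x‖⁴`. [folklore] -/
theorem averagingError_le (P : Finset X) (P' : Finset Y) {w : Y → X → ℝ} {Φ : Y → X → V} {φ : X → V}
    {ψ : Y → V} {e : V → ℝ} {q r c : ℝ} {ρ : Y → ℝ}
    (he : ∀ v, ‖v‖ ^ 2 / 2 - q * ‖v‖ ^ 4 ≤ e v ∧ e v ≤ ‖v‖ ^ 2 / 2)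
    (hw : ∀ y ∈ P', ∀ x ∈ P, 0 ≤ w y x) (hr : 0 ≤ r) (hrow : ∀ y ∈ P', ∑ x ∈ P, w y x ≤ r)
    (hcol : ∀ x ∈ P, ∑ y ∈ P', w y x ≤ c) (hΦ : ∀ y ∈ P', ∀ x ∈ P, ‖Φ y x‖ = ‖φ x‖)
    (hρ : ∀ y ∈ P', ‖ψ y - ∑ x ∈ P, w y x • Φ y x‖ ≤ ρ y) :
    ∑ y ∈ P', e (ψ y) - ∑ x ∈ P, e (φ x)
      ≤ (r * c - 1) / 2 * ∑ x ∈ P, ‖φ x‖ ^ 2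
        + ∑ y ∈ P', (‖∑ x ∈ P, w y x • Φ y x‖ * ρ y + ρ y ^ 2 / 2) + q * ∑ x ∈ P, ‖φ x‖ ^ 4 := by
  have f1 : ∑ y ∈ P', e (ψ y)
      ≤ ∑ y ∈ P', (‖∑ x ∈ P, w y x • Φ y x‖ ^ 2 / 2 + (‖∑ x ∈ P, w y x • Φ y x‖ * ρ y + ρ y ^ 2 / 2)) := by
    refine Finset.sum_le_sum fun y hy => ?_
    have h1 : ‖ψ y‖ ≤ ‖∑ x ∈ P, w y x • Φ y x‖ + ρ y :=
      (norm_le_norm_add_norm_sub' (ψ y) (∑ x ∈ P, w y x • Φ y x)).trans (add_le_add le_rfl (hρ y hy))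
    have h2 : ‖ψ y‖ ^ 2 ≤ (‖∑ x ∈ P, w y x • Φ y x‖ + ρ y) ^ 2 := pow_le_pow_left₀ (norm_nonneg _) h1 2
    have h3 := (he (ψ y)).2
    nlinarith [h2, h3]
  have f2 : ∑ y ∈ P', (‖∑ x ∈ P, w y x • Φ y x‖ ^ 2 / 2 + (‖∑ x ∈ P, w y x • Φ y x‖ * ρ y + ρ y ^ 2 / 2))
      = (∑ y ∈ P', ‖∑ x ∈ P, w y x • Φ y x‖ ^ 2) / 2
        + ∑ y ∈ P', (‖∑ x ∈ P, w y x • Φ y x‖ * ρ y + ρ y ^ 2 / 2) := by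
    rw [Finset.sum_add_distrib, Finset.sum_div]
  have f3 : ∑ y ∈ P', ‖∑ x ∈ P, w y x • Φ y x‖ ^ 2 ≤ r * c * ∑ x ∈ P, ‖φ x‖ ^ 2 :=
    blockedQuadratic_norm_le P P' hw hr hrow hcol hΦ
  have f4 : ∑ x ∈ P, (‖φ x‖ ^ 2 / 2 - q * ‖φ x‖ ^ 4) ≤ ∑ x ∈ P, e (φ x) :=
    Finset.sum_le_sum fun x _ => (he (φ x)).1
  have f5 : ∑ x ∈ P, (‖φ x‖ ^ 2 / 2 - q * ‖φ x‖ ^ 4) = (∑ x ∈ P, ‖φ x‖ ^ 2) / 2 - q * ∑ x ∈ P, ‖φ x‖ ^ 4 := by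
    rw [Finset.sum_sub_distrib, Finset.sum_div, Finset.mul_sum]
  linarith [f1, f2, f3, f4, f5]

/-- **THE INTERPOLATION ERROR (U) WITH REMAINDERS.**  As `averagingError_le`, with EXACT normalisation (row sums `= r`,
column sums `= c`) and the transported fine field oscillating by at most `osc(y)` over the window of `y`:
`Σ_x e(φ x) − Σ_y e(ψ y) ≤ (1 − rc)/2·Σ‖φ‖² + (r²/4)·Σ_y osc_y² + Σ_y ‖Σ_x w•Φ‖·ρ_y + q·Σ_y ‖ψ y‖⁴`. [folklore] -/
theorem interpolationError_le (P : Finset X) (P' : Finset Y) {w : Y → X → ℝ} {Φ : Y → X → V} {φ : X → V}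
    {ψ : Y → V} {e : V → ℝ} {q r c : ℝ} {ρ osc : Y → ℝ}
    (he : ∀ v, ‖v‖ ^ 2 / 2 - q * ‖v‖ ^ 4 ≤ e v ∧ e v ≤ ‖v‖ ^ 2 / 2)
    (hw : ∀ y ∈ P', ∀ x ∈ P, 0 ≤ w y x) (hrow : ∀ y ∈ P', ∑ x ∈ P, w y x = r)
    (hcol : ∀ x ∈ P, ∑ y ∈ P', w y x = c) (hΦ : ∀ y ∈ P', ∀ x ∈ P, ‖Φ y x‖ = ‖φ x‖)
    (hosc : ∀ y ∈ P', ∀ x ∈ P, ∀ x' ∈ P, 0 < w y x → 0 < w y x' → ‖Φ y x - Φ y x'‖ ≤ osc y)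
    (hρ : ∀ y ∈ P', ‖ψ y - ∑ x ∈ P, w y x • Φ y x‖ ≤ ρ y) :
    ∑ x ∈ P, e (φ x) - ∑ y ∈ P', e (ψ y)
      ≤ (1 - r * c) / 2 * ∑ x ∈ P, ‖φ x‖ ^ 2 + r ^ 2 / 4 * ∑ y ∈ P', osc y ^ 2
        + ∑ y ∈ P', ‖∑ x ∈ P, w y x • Φ y x‖ * ρ y + q * ∑ y ∈ P', ‖ψ y‖ ^ 4 := by
  have g1 : ∑ x ∈ P, e (φ x) ≤ ∑ x ∈ P, ‖φ x‖ ^ 2 / 2 := Finset.sum_le_sum fun x _ => (he (φ x)).2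
  have g1' : ∑ x ∈ P, ‖φ x‖ ^ 2 / 2 = (∑ x ∈ P, ‖φ x‖ ^ 2) / 2 := (Finset.sum_div _ _ _).symm
  have g2 := jensenGap_norm_le P P' hw hrow hcol hΦ hosc
  have g3 : ∑ y ∈ P', (‖ψ y‖ ^ 2 / 2 - q * ‖ψ y‖ ^ 4) ≤ ∑ y ∈ P', e (ψ y) :=
    Finset.sum_le_sum fun y _ => (he (ψ y)).1
  have g3' : ∑ y ∈ P', (‖ψ y‖ ^ 2 / 2 - q * ‖ψ y‖ ^ 4) = (∑ y ∈ P', ‖ψ y‖ ^ 2) / 2 - q * ∑ y ∈ P', ‖ψ y‖ ^ 4 := by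
    rw [Finset.sum_sub_distrib, Finset.sum_div, Finset.mul_sum]
  have g4 : ∑ y ∈ P', (‖∑ x ∈ P, w y x • Φ y x‖ ^ 2 - 2 * (‖∑ x ∈ P, w y x • Φ y x‖ * ρ y))
      ≤ ∑ y ∈ P', ‖ψ y‖ ^ 2 := by
    refine Finset.sum_le_sum fun y hy => sq_sub_two_mul_le_sq (norm_nonneg _) (norm_nonneg _) ?_
    calc ‖∑ x ∈ P, w y x • Φ y x‖ ≤ ‖ψ y‖ + ‖∑ x ∈ P, w y x • Φ y x - ψ y‖ := norm_le_norm_add_norm_sub' _ _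
      _ ≤ ‖ψ y‖ + ρ y := by rw [norm_sub_rev]; exact add_le_add le_rfl (hρ y hy)
  have g4' : ∑ y ∈ P', (‖∑ x ∈ P, w y x • Φ y x‖ ^ 2 - 2 * (‖∑ x ∈ P, w y x • Φ y x‖ * ρ y))
      = ∑ y ∈ P', ‖∑ x ∈ P, w y x • Φ y x‖ ^ 2 - 2 * ∑ y ∈ P', ‖∑ x ∈ P, w y x • Φ y x‖ * ρ y := by
    rw [Finset.sum_sub_distrib, Finset.mul_sum]
  linarith [g1, g1', g2, g3, g3', g4, g4']

end Deviation

/-! ## §3 Sizes: uniform bounds on the field, the oscillation, the BCH remainder and the plaquette counts -/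

section Sizes

variable {V : Type*} [NormedAddCommGroup V] [InnerProductSpace ℝ V] {X Y : Type*}

/-- The kernel average of a transported field of size `≤ s` has norm `≤ r·s` (row sums `≤ r`, `0 ≤ s`). [folklore] -/
theorem norm_blockAverage_le (P : Finset X) {w : X → ℝ} {Φ φ : X → V} {r s : ℝ} (hw : ∀ x ∈ P, 0 ≤ w x)
    (hrow : ∑ x ∈ P, w x ≤ r) (hΦ : ∀ x ∈ P, ‖Φ x‖ = ‖φ x‖) (hs : 0 ≤ s) (hφ : ∀ x ∈ P, ‖φ x‖ ≤ s) :
    ‖∑ x ∈ P, w x • Φ x‖ ≤ r * s := by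
  calc ‖∑ x ∈ P, w x • Φ x‖ ≤ ∑ x ∈ P, ‖w x • Φ x‖ := norm_sum_le _ _
    _ = ∑ x ∈ P, w x * ‖φ x‖ := Finset.sum_congr rfl fun x hx => by
        rw [norm_smul, Real.norm_eq_abs, abs_of_nonneg (hw x hx), hΦ x hx]
    _ ≤ ∑ x ∈ P, w x * s := Finset.sum_le_sum fun x hx => mul_le_mul_of_nonneg_left (hφ x hx) (hw x hx)
    _ = (∑ x ∈ P, w x) * s := (Finset.sum_mul _ _ _).symm
    _ ≤ r * s := mul_le_mul_of_nonneg_right hrow hs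

/-- **(L) IN SIZES.**  `rc ≤ 1`, `‖φ‖ ≤ s` on `P`, BCH remainder `≤ ρb`, `#P ≤ Nf`, `#P′ ≤ Nc`:
`Σ_y e(ψ y) − Σ_x e(φ x) ≤ Nc·(r·s·ρb + ρb²/2) + q·(Nf·s⁴)`. [folklore] -/
theorem averagingError_le_of_sizes (P : Finset X) (P' : Finset Y) {w : Y → X → ℝ} {Φ : Y → X → V} {φ : X → V}
    {ψ : Y → V} {e : V → ℝ} {q r c s ρb Nf Nc : ℝ}
    (he : ∀ v, ‖v‖ ^ 2 / 2 - q * ‖v‖ ^ 4 ≤ e v ∧ e v ≤ ‖v‖ ^ 2 / 2) (hq : 0 ≤ q)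
    (hw : ∀ y ∈ P', ∀ x ∈ P, 0 ≤ w y x) (hr : 0 ≤ r) (hrow : ∀ y ∈ P', ∑ x ∈ P, w y x ≤ r)
    (hcol : ∀ x ∈ P, ∑ y ∈ P', w y x ≤ c) (hrc : r * c ≤ 1) (hΦ : ∀ y ∈ P', ∀ x ∈ P, ‖Φ y x‖ = ‖φ x‖)
    (hs : 0 ≤ s) (hφ : ∀ x ∈ P, ‖φ x‖ ≤ s) (hρb : 0 ≤ ρb)
    (hρ : ∀ y ∈ P', ‖ψ y - ∑ x ∈ P, w y x • Φ y x‖ ≤ ρb)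
    (hNf : (P.card : ℝ) ≤ Nf) (hNc : (P'.card : ℝ) ≤ Nc) :
    ∑ y ∈ P', e (ψ y) - ∑ x ∈ P, e (φ x) ≤ Nc * (r * s * ρb + ρb ^ 2 / 2) + q * (Nf * s ^ 4) := by
  have h0 := averagingError_le P P' (ρ := fun _ => ρb) he hw hr hrow hcol hΦ hρ
  have hA : 0 ≤ ∑ x ∈ P, ‖φ x‖ ^ 2 := Finset.sum_nonneg fun x _ => by positivity
  have h1 : ∑ y ∈ P', (‖∑ x ∈ P, w y x • Φ y x‖ * ρb + ρb ^ 2 / 2) ≤ ∑ y ∈ P', (r * s * ρb + ρb ^ 2 / 2) :=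
    Finset.sum_le_sum fun y hy => add_le_add
      (mul_le_mul_of_nonneg_right (norm_blockAverage_le P (hw y hy) (hrow y hy) (hΦ y hy) hs hφ) hρb) le_rfl
  have h2 : ∑ y ∈ P', (r * s * ρb + ρb ^ 2 / 2) ≤ Nc * (r * s * ρb + ρb ^ 2 / 2) := by
    rw [Finset.sum_const, nsmul_eq_mul]
    exact mul_le_mul_of_nonneg_right hNc (by positivity)
  have h3 : ∑ x ∈ P, ‖φ x‖ ^ 4 ≤ Nf * s ^ 4 := by
    calc ∑ x ∈ P, ‖φ x‖ ^ 4 ≤ ∑ x ∈ P, s ^ 4 :=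
          Finset.sum_le_sum fun x hx => pow_le_pow_left₀ (norm_nonneg _) (hφ x hx) 4
      _ = P.card * s ^ 4 := by rw [Finset.sum_const, nsmul_eq_mul]
      _ ≤ Nf * s ^ 4 := mul_le_mul_of_nonneg_right hNf (by positivity)
  have h4 : (r * c - 1) / 2 * ∑ x ∈ P, ‖φ x‖ ^ 2 ≤ 0 := by nlinarith [hA, hrc]
  linarith [h0, h1, h2, h4, mul_le_mul_of_nonneg_left h3 hq]

/-- **(U) IN SIZES.**  Exact normalisation with `1 ≤ rc`, `0 ≤ r`, `‖φ‖ ≤ s` on `P`, window oscillation `≤ ω`, BCH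
remainder `≤ ρb`, `#P′ ≤ Nc`: `Σ_x e(φ x) − Σ_y e(ψ y) ≤ Nc·(r²ω²/4 + r·s·ρb + q·(r·s + ρb)⁴)`. [folklore] -/
theorem interpolationError_le_of_sizes (P : Finset X) (P' : Finset Y) {w : Y → X → ℝ} {Φ : Y → X → V}
    {φ : X → V} {ψ : Y → V} {e : V → ℝ} {q r c s ω ρb Nc : ℝ}
    (he : ∀ v, ‖v‖ ^ 2 / 2 - q * ‖v‖ ^ 4 ≤ e v ∧ e v ≤ ‖v‖ ^ 2 / 2) (hq : 0 ≤ q)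
    (hw : ∀ y ∈ P', ∀ x ∈ P, 0 ≤ w y x) (hr : 0 ≤ r) (hrow : ∀ y ∈ P', ∑ x ∈ P, w y x = r)
    (hcol : ∀ x ∈ P, ∑ y ∈ P', w y x = c) (hrc : 1 ≤ r * c) (hΦ : ∀ y ∈ P', ∀ x ∈ P, ‖Φ y x‖ = ‖φ x‖)
    (hs : 0 ≤ s) (hφ : ∀ x ∈ P, ‖φ x‖ ≤ s)
    (hosc : ∀ y ∈ P', ∀ x ∈ P, ∀ x' ∈ P, 0 < w y x → 0 < w y x' → ‖Φ y x - Φ y x'‖ ≤ ω)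
    (hρb : 0 ≤ ρb) (hρ : ∀ y ∈ P', ‖ψ y - ∑ x ∈ P, w y x • Φ y x‖ ≤ ρb) (hNc : (P'.card : ℝ) ≤ Nc) :
    ∑ x ∈ P, e (φ x) - ∑ y ∈ P', e (ψ y) ≤ Nc * (r ^ 2 * ω ^ 2 / 4 + r * s * ρb + q * (r * s + ρb) ^ 4) := by
  have h0 := interpolationError_le P P' (ρ := fun _ => ρb) (osc := fun _ => ω) he hw hrow hcol hΦ hosc hρ
  have hA : 0 ≤ ∑ x ∈ P, ‖φ x‖ ^ 2 := Finset.sum_nonneg fun x _ => by positivity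
  have hW : ∀ y ∈ P', ‖∑ x ∈ P, w y x • Φ y x‖ ≤ r * s :=
    fun y hy => norm_blockAverage_le P (hw y hy) (hrow y hy).le (hΦ y hy) hs hφ
  have hψ : ∀ y ∈ P', ‖ψ y‖ ≤ r * s + ρb := by
    intro y hy
    calc ‖ψ y‖ ≤ ‖∑ x ∈ P, w y x • Φ y x‖ + ‖ψ y - ∑ x ∈ P, w y x • Φ y x‖ := norm_le_norm_add_norm_sub' _ _
      _ ≤ r * s + ρb := add_le_add (hW y hy) (hρ y hy)
  have h1 : ∑ y ∈ P', ‖∑ x ∈ P, w y x • Φ y x‖ * ρb ≤ ∑ y ∈ P', r * s * ρb :=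
    Finset.sum_le_sum fun y hy => mul_le_mul_of_nonneg_right (hW y hy) hρb
  have h2 : ∑ y ∈ P', ‖ψ y‖ ^ 4 ≤ ∑ y ∈ P', (r * s + ρb) ^ 4 :=
    Finset.sum_le_sum fun y hy => pow_le_pow_left₀ (norm_nonneg _) (hψ y hy) 4
  have h3 : r ^ 2 / 4 * ∑ y ∈ P', ω ^ 2 + ∑ y ∈ P', r * s * ρb + q * ∑ y ∈ P', (r * s + ρb) ^ 4
      = P'.card * (r ^ 2 * ω ^ 2 / 4 + r * s * ρb + q * (r * s + ρb) ^ 4) := by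
    simp only [Finset.sum_const, nsmul_eq_mul]
    ring
  have h4 : (P'.card : ℝ) * (r ^ 2 * ω ^ 2 / 4 + r * s * ρb + q * (r * s + ρb) ^ 4)
      ≤ Nc * (r ^ 2 * ω ^ 2 / 4 + r * s * ρb + q * (r * s + ρb) ^ 4) :=
    mul_le_mul_of_nonneg_right hNc (by positivity)
  have h5 : (1 - r * c) / 2 * ∑ x ∈ P, ‖φ x‖ ^ 2 ≤ 0 := by nlinarith [hA, hrc]
  linarith [h0, h1, mul_le_mul_of_nonneg_left h2 hq, h3, h4, h5]

end Sizes

/-! ## §4 Scaling: the sizes of one renormalisation step at scale `a = L^{−K}` give ONE POWER of `a²` — the geometric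
## factor `ξ = L⁻²` — and `Σ dU, Σ dL < ∞` -/

section Scaling

/-- **(L) AT SCALE `a`.**  With `b ≤ a ≤ 1` (`b = a/L` the fine spacing), `r·b² = a²` (`r = L²`), field size
`s ≤ c₁ε₁b²`, BCH remainder `ρb ≤ c₃ε₁²a⁴`, counts `Nf·b⁴, Nc·a⁴ ≤ n₀·vol`: the (L) size bound is
`≤ vol·(n₀·(c₁c₃ε₁³ + c₃²ε₁⁴/2 + q·c₁⁴ε₁⁴)·a²)`. [folklore] -/
theorem averagingSize_le_scale {q r s ρb Nf Nc n₀ vol c₁ c₃ ε₁ a b : ℝ} (hq : 0 ≤ q) (hr : 0 ≤ r)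
    (hn₀ : 0 ≤ n₀) (hvol : 0 ≤ vol) (hc₁ : 0 ≤ c₁) (hc₃ : 0 ≤ c₃) (hε₁ : 0 ≤ ε₁)
    (ha0 : 0 < a) (ha1 : a ≤ 1) (hb0 : 0 ≤ b) (hba : b ≤ a) (hrb : r * b ^ 2 = a ^ 2)
    (hs0 : 0 ≤ s) (hs : s ≤ c₁ * ε₁ * b ^ 2) (hρ0 : 0 ≤ ρb) (hρb : ρb ≤ c₃ * ε₁ ^ 2 * a ^ 4)
    (hNf0 : 0 ≤ Nf) (hNf : Nf * b ^ 4 ≤ n₀ * vol) (hNc0 : 0 ≤ Nc) (hNc : Nc * a ^ 4 ≤ n₀ * vol) :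
    Nc * (r * s * ρb + ρb ^ 2 / 2) + q * (Nf * s ^ 4)
      ≤ vol * (n₀ * (c₁ * c₃ * ε₁ ^ 3 + c₃ ^ 2 * ε₁ ^ 4 / 2 + q * (c₁ ^ 4 * ε₁ ^ 4)) * a ^ 2) := by
  have ha2 : a ^ 4 ≤ a ^ 2 := pow_le_pow_of_le_one ha0.le ha1 (by norm_num)
  have hb4 : b ^ 4 ≤ a ^ 2 := (pow_le_pow_left₀ hb0 hba 4).trans ha2
  have hrs : r * s ≤ c₁ * ε₁ * a ^ 2 := by
    calc r * s ≤ r * (c₁ * ε₁ * b ^ 2) := mul_le_mul_of_nonneg_left hs hr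
      _ = c₁ * ε₁ * (r * b ^ 2) := by ring
      _ = c₁ * ε₁ * a ^ 2 := by rw [hrb]
  have t1 : Nc * (r * s * ρb) ≤ c₁ * c₃ * ε₁ ^ 3 * a ^ 2 * (n₀ * vol) := by
    calc Nc * (r * s * ρb) ≤ Nc * (c₁ * ε₁ * a ^ 2 * (c₃ * ε₁ ^ 2 * a ^ 4)) :=
          mul_le_mul_of_nonneg_left (mul_le_mul hrs hρb hρ0 (by positivity)) hNc0
      _ = c₁ * c₃ * ε₁ ^ 3 * a ^ 2 * (Nc * a ^ 4) := by ring
      _ ≤ c₁ * c₃ * ε₁ ^ 3 * a ^ 2 * (n₀ * vol) := mul_le_mul_of_nonneg_left hNc (by positivity)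
  have t2 : Nc * (ρb ^ 2 / 2) ≤ c₃ ^ 2 * ε₁ ^ 4 / 2 * a ^ 2 * (n₀ * vol) := by
    calc Nc * (ρb ^ 2 / 2) ≤ Nc * ((c₃ * ε₁ ^ 2 * a ^ 4) ^ 2 / 2) :=
          mul_le_mul_of_nonneg_left (by gcongr) hNc0
      _ = c₃ ^ 2 * ε₁ ^ 4 / 2 * a ^ 4 * (Nc * a ^ 4) := by ring
      _ ≤ c₃ ^ 2 * ε₁ ^ 4 / 2 * a ^ 4 * (n₀ * vol) := mul_le_mul_of_nonneg_left hNc (by positivity)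
      _ ≤ c₃ ^ 2 * ε₁ ^ 4 / 2 * a ^ 2 * (n₀ * vol) := by gcongr
  have t3 : q * (Nf * s ^ 4) ≤ q * (c₁ ^ 4 * ε₁ ^ 4) * a ^ 2 * (n₀ * vol) := by
    calc q * (Nf * s ^ 4) ≤ q * (Nf * (c₁ * ε₁ * b ^ 2) ^ 4) := by gcongr
      _ = q * (c₁ ^ 4 * ε₁ ^ 4) * b ^ 4 * (Nf * b ^ 4) := by ring
      _ ≤ q * (c₁ ^ 4 * ε₁ ^ 4) * b ^ 4 * (n₀ * vol) := mul_le_mul_of_nonneg_left hNf (by positivity)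
      _ ≤ q * (c₁ ^ 4 * ε₁ ^ 4) * a ^ 2 * (n₀ * vol) := by gcongr
  linarith [t1, t2, t3]

/-- **(U) AT SCALE `a`.**  As `averagingSize_le_scale`, with the window oscillation `ω ≤ c₂ε₁b²a` (unit-scale smoothness
of the lift): the (U) size bound is `≤ vol·(n₀·(c₂²ε₁²/4 + c₁c₃ε₁³ + q·(c₁ε₁ + c₃ε₁²)⁴)·a²)`. [folklore] -/
theorem interpolationSize_le_scale {q r s ω ρb Nc n₀ vol c₁ c₂ c₃ ε₁ a b : ℝ} (hq : 0 ≤ q) (hr : 0 ≤ r)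
    (hn₀ : 0 ≤ n₀) (hvol : 0 ≤ vol) (hc₁ : 0 ≤ c₁) (hc₃ : 0 ≤ c₃) (hε₁ : 0 ≤ ε₁)
    (ha0 : 0 < a) (ha1 : a ≤ 1) (hrb : r * b ^ 2 = a ^ 2)
    (hs0 : 0 ≤ s) (hs : s ≤ c₁ * ε₁ * b ^ 2) (hω0 : 0 ≤ ω) (hω : ω ≤ c₂ * ε₁ * b ^ 2 * a)
    (hρ0 : 0 ≤ ρb) (hρb : ρb ≤ c₃ * ε₁ ^ 2 * a ^ 4) (hNc0 : 0 ≤ Nc) (hNc : Nc * a ^ 4 ≤ n₀ * vol) :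
    Nc * (r ^ 2 * ω ^ 2 / 4 + r * s * ρb + q * (r * s + ρb) ^ 4)
      ≤ vol * (n₀ * (c₂ ^ 2 * ε₁ ^ 2 / 4 + c₁ * c₃ * ε₁ ^ 3 + q * (c₁ * ε₁ + c₃ * ε₁ ^ 2) ^ 4) * a ^ 2) := by
  have ha2 : a ^ 4 ≤ a ^ 2 := pow_le_pow_of_le_one ha0.le ha1 (by norm_num)
  have hrs : r * s ≤ c₁ * ε₁ * a ^ 2 := by
    calc r * s ≤ r * (c₁ * ε₁ * b ^ 2) := mul_le_mul_of_nonneg_left hs hr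
      _ = c₁ * ε₁ * (r * b ^ 2) := by ring
      _ = c₁ * ε₁ * a ^ 2 := by rw [hrb]
  have hrω : r * ω ≤ c₂ * ε₁ * a ^ 3 := by
    calc r * ω ≤ r * (c₂ * ε₁ * b ^ 2 * a) := mul_le_mul_of_nonneg_left hω hr
      _ = c₂ * ε₁ * a * (r * b ^ 2) := by ring
      _ = c₂ * ε₁ * a ^ 3 := by rw [hrb]; ring
  have u1 : Nc * (r ^ 2 * ω ^ 2 / 4) ≤ c₂ ^ 2 * ε₁ ^ 2 / 4 * a ^ 2 * (n₀ * vol) := by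
    have h : (r * ω) ^ 2 ≤ (c₂ * ε₁ * a ^ 3) ^ 2 := pow_le_pow_left₀ (mul_nonneg hr hω0) hrω 2
    calc Nc * (r ^ 2 * ω ^ 2 / 4) = Nc * ((r * ω) ^ 2 / 4) := by ring
      _ ≤ Nc * ((c₂ * ε₁ * a ^ 3) ^ 2 / 4) := mul_le_mul_of_nonneg_left (by gcongr) hNc0
      _ = c₂ ^ 2 * ε₁ ^ 2 / 4 * a ^ 2 * (Nc * a ^ 4) := by ring
      _ ≤ c₂ ^ 2 * ε₁ ^ 2 / 4 * a ^ 2 * (n₀ * vol) := mul_le_mul_of_nonneg_left hNc (by positivity)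
  have u2 : Nc * (r * s * ρb) ≤ c₁ * c₃ * ε₁ ^ 3 * a ^ 2 * (n₀ * vol) := by
    calc Nc * (r * s * ρb) ≤ Nc * (c₁ * ε₁ * a ^ 2 * (c₃ * ε₁ ^ 2 * a ^ 4)) :=
          mul_le_mul_of_nonneg_left (mul_le_mul hrs hρb hρ0 (by positivity)) hNc0
      _ = c₁ * c₃ * ε₁ ^ 3 * a ^ 2 * (Nc * a ^ 4) := by ring
      _ ≤ c₁ * c₃ * ε₁ ^ 3 * a ^ 2 * (n₀ * vol) := mul_le_mul_of_nonneg_left hNc (by positivity)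
  have u3 : Nc * (q * (r * s + ρb) ^ 4) ≤ q * (c₁ * ε₁ + c₃ * ε₁ ^ 2) ^ 4 * a ^ 2 * (n₀ * vol) := by
    have hsum : r * s + ρb ≤ (c₁ * ε₁ + c₃ * ε₁ ^ 2) * a ^ 2 := by
      have : c₃ * ε₁ ^ 2 * a ^ 4 ≤ c₃ * ε₁ ^ 2 * a ^ 2 := mul_le_mul_of_nonneg_left ha2 (by positivity)
      linarith [hrs, hρb, this]
    have h4 : (r * s + ρb) ^ 4 ≤ ((c₁ * ε₁ + c₃ * ε₁ ^ 2) * a ^ 2) ^ 4 :=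
      pow_le_pow_left₀ (add_nonneg (mul_nonneg hr hs0) hρ0) hsum 4
    calc Nc * (q * (r * s + ρb) ^ 4) ≤ Nc * (q * ((c₁ * ε₁ + c₃ * ε₁ ^ 2) * a ^ 2) ^ 4) :=
          mul_le_mul_of_nonneg_left (mul_le_mul_of_nonneg_left h4 hq) hNc0
      _ = q * (c₁ * ε₁ + c₃ * ε₁ ^ 2) ^ 4 * a ^ 4 * (Nc * a ^ 4) := by ring
      _ ≤ q * (c₁ * ε₁ + c₃ * ε₁ ^ 2) ^ 4 * a ^ 4 * (n₀ * vol) := mul_le_mul_of_nonneg_left hNc (by positivity)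
      _ ≤ q * (c₁ * ε₁ + c₃ * ε₁ ^ 2) ^ 4 * a ^ 2 * (n₀ * vol) := by gcongr
  have e : Nc * (r ^ 2 * ω ^ 2 / 4 + r * s * ρb + q * (r * s + ρb) ^ 4)
      = Nc * (r ^ 2 * ω ^ 2 / 4) + Nc * (r * s * ρb) + Nc * (q * (r * s + ρb) ^ 4) := by ring
  rw [e]
  linarith [u1, u2, u3]

/-- The scale facts at `a = (L^K)⁻¹`, `b = (L^{K+1})⁻¹`, `r = L²`, for `1 < L`. [folklore] -/
theorem scale_facts {L : ℝ} (hL : 1 < L) (K : ℕ) :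
    0 < (L ^ K)⁻¹ ∧ (L ^ K)⁻¹ ≤ 1 ∧ 0 ≤ (L ^ (K + 1))⁻¹ ∧ (L ^ (K + 1))⁻¹ ≤ (L ^ K)⁻¹ ∧
      L ^ 2 * ((L ^ (K + 1))⁻¹) ^ 2 = ((L ^ K)⁻¹) ^ 2 ∧ ((L ^ K)⁻¹) ^ 2 = ((L ^ 2)⁻¹) ^ K := by
  have hL0 : 0 < L := by linarith
  have hK : 1 ≤ L ^ K := one_le_pow₀ hL.le
  refine ⟨by positivity, inv_le_one_of_one_le₀ hK, by positivity, ?_, ?_, ?_⟩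
  · exact inv_anti₀ (by positivity) (pow_le_pow_right₀ hL.le (Nat.le_succ K))
  · have h1 : L ^ (K + 1) ≠ 0 := pow_ne_zero _ hL0.ne'
    have h2 : L ^ K ≠ 0 := pow_ne_zero _ hL0.ne'
    field_simp
    ring
  · rw [inv_pow, inv_pow, ← pow_mul, ← pow_mul, mul_comm]

/-- `K ↦ C·(L⁻²)^K` is non-negative and summable for `1 < L`, `0 ≤ C`. [folklore] -/
theorem geometricRate_nonneg_summable {L C : ℝ} (hL : 1 < L) (hC : 0 ≤ C) :
    (∀ K : ℕ, 0 ≤ C * ((L ^ 2)⁻¹) ^ K) ∧ Summable (fun K : ℕ => C * ((L ^ 2)⁻¹) ^ K) := by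
  have h0 : 0 ≤ (L ^ 2)⁻¹ := by positivity
  have h1 : (L ^ 2)⁻¹ < 1 := inv_lt_one_of_one_lt₀ (by nlinarith)
  exact ⟨fun K => mul_nonneg hC (pow_nonneg h0 K), (summable_geometric_of_lt_one h0 h1).mul_left _⟩

end Scaling

/-! ## §5 (U) and (L) PRODUCED along the tower, and the route's capstone RE-KEYED -/

section Indexed

variable {V : Type*} [NormedAddCommGroup V] [InnerProductSpace ℝ V] {Xf Xc : Type*} {ι : Type} {σ : Type*}
  [DecidableEq σ] {l₀ vol : ℝ} {T : ℕ → Finset σ} {Bad : ℕ → ℝ → Finset σ} {Adm : Set ι}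

/-- From a count `N ≤ M·x⁴` (`0 < x`): `N·(x⁻¹)⁴ ≤ M`. [folklore] -/
theorem count_mul_inv_pow_le {N M x : ℝ} (hx : 0 < x) (h : N ≤ M * x ^ 4) : N * (x⁻¹) ^ 4 ≤ M := by
  rw [inv_pow, ← div_eq_mul_inv, div_le_iff₀ (pow_pos hx 4)]
  exact h

/-- **(U)(L) PRODUCED FROM THE REGULARITY OF ONE RENORMALISATION STEP.**  Binders, for every scale `K` and every good
term's admissible data: (wt) the plaquette weight `e` on a real inner-product space `V` with the quartic sandwich
`‖v‖²/2 − q₄‖v‖⁴ ≤ e v ≤ ‖v‖²/2`, `0 ≤ q₄`; (ker) the one-step average acting on plaquette variables as a non-negative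
kernel `w_K(y,x)` from the fine plaquettes `Pf K` to the coarse ones `Pc K` with row sums `L²` and column sums `L⁻²`
(`1 < L`; `rc = 1`, d = 4); (cnt) `#Pf K ≤ n₀·vol·L^{4(K+1)}`, `#Pc K ≤ n₀·vol·L^{4K}`; for the LIFT `yA` of run A's
background `xA`: (repr-U) `f₁(yA) = Σ_{x∈Pf} e(φA x)`, `g(xA) = Σ_{y∈Pc} e(ψA y)`, (tr-U) the transported field
`‖ΦA y x‖ = ‖φA x‖`, (bch-U) `‖ψA y − Σ_x w•ΦA y x‖ ≤ ρb_K`, (sz-U) `‖φA x‖ ≤ s_K`, (osc-U) `‖ΦA y x − ΦA y x′‖ ≤ ω_K` on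
the window of `y`; for run B's background `yB` and its average `Q yB`: (repr-L) `f₁(yB) = Σ_x e(φB x)`, `g(Q yB) = Σ_y
e(ψB y)`, (tr-L), (bch-L) `≤ ρb_K`, (sz-L) `≤ s_K`; (scal) `0 ≤ s_K ≤ c₁ε₁L^{−2(K+1)}`, `0 ≤ ω_K ≤
c₂ε₁L^{−2(K+1)}L^{−K}`, `0 ≤ ρb_K ≤ c₃ε₁²L^{−4K}`, `0 ≤ c₁, c₃, ε₁, n₀, vol`.  OUTPUT: generation 9's binders (U) `hUdev`,
(L) `hLdev`, `hdU0`, `hdL0`, `hdU`, `hdL` with the EXPLICIT GEOMETRIC majorants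
`dU_K = n₀·(c₂²ε₁²/4 + c₁c₃ε₁³ + q₄(c₁ε₁ + c₃ε₁²)⁴)·(L⁻²)^K`, `dL_K = n₀·(c₁c₃ε₁³ + c₃²ε₁⁴/2 + q₄c₁⁴ε₁⁴)·(L⁻²)^K`.
[folklore] -/
theorem interpolation_averaging_of_regular {Y YA : Type*} {g : ℕ → ℝ → σ → ι → YA → ℝ}
    {f₁ : ℕ → ℝ → σ → ι → Y → ℝ} {Q : ℕ → ℝ → σ → ι → Y → YA} {yA yB : ℕ → ℝ → σ → ι → Y}
    {xA : ℕ → ℝ → σ → ι → YA} {Pf : ℕ → Finset Xf} {Pc : ℕ → Finset Xc} {w : ℕ → Xc → Xf → ℝ} {e : V → ℝ}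
    {φA φB : ℕ → ℝ → σ → ι → Xf → V} {ψA ψB : ℕ → ℝ → σ → ι → Xc → V} {ΦA ΦB : ℕ → ℝ → σ → ι → Xc → Xf → V}
    {q₄ L n₀ c₁ c₂ c₃ ε₁ : ℝ} {s ω ρb : ℕ → ℝ}
    (he : ∀ v, ‖v‖ ^ 2 / 2 - q₄ * ‖v‖ ^ 4 ≤ e v ∧ e v ≤ ‖v‖ ^ 2 / 2) (hq₄ : 0 ≤ q₄) (hL : 1 < L)
    (hw : ∀ K, ∀ y ∈ Pc K, ∀ x ∈ Pf K, 0 ≤ w K y x) (hrow : ∀ K, ∀ y ∈ Pc K, ∑ x ∈ Pf K, w K y x = L ^ 2)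
    (hcol : ∀ K, ∀ x ∈ Pf K, ∑ y ∈ Pc K, w K y x = (L ^ 2)⁻¹) (hn₀ : 0 ≤ n₀) (hvol : 0 ≤ vol)
    (hNf : ∀ K, ((Pf K).card : ℝ) ≤ n₀ * vol * (L ^ (K + 1)) ^ 4)
    (hNc : ∀ K, ((Pc K).card : ℝ) ≤ n₀ * vol * (L ^ K) ^ 4)
    (hreprU : ∀ K t, |t| ≤ l₀ → ∀ τ ∈ T K \ Bad K t, ∀ v ∈ Adm,
      f₁ K t τ v (yA K t τ v) = ∑ x ∈ Pf K, e (φA K t τ v x) ∧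
        g K t τ v (xA K t τ v) = ∑ y ∈ Pc K, e (ψA K t τ v y))
    (hΦA : ∀ K t, |t| ≤ l₀ → ∀ τ ∈ T K \ Bad K t, ∀ v ∈ Adm, ∀ y ∈ Pc K, ∀ x ∈ Pf K,
      ‖ΦA K t τ v y x‖ = ‖φA K t τ v x‖)
    (hρA : ∀ K t, |t| ≤ l₀ → ∀ τ ∈ T K \ Bad K t, ∀ v ∈ Adm, ∀ y ∈ Pc K,
      ‖ψA K t τ v y - ∑ x ∈ Pf K, w K y x • ΦA K t τ v y x‖ ≤ ρb K)
    (hsA : ∀ K t, |t| ≤ l₀ → ∀ τ ∈ T K \ Bad K t, ∀ v ∈ Adm, ∀ x ∈ Pf K, ‖φA K t τ v x‖ ≤ s K)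
    (hoscA : ∀ K t, |t| ≤ l₀ → ∀ τ ∈ T K \ Bad K t, ∀ v ∈ Adm, ∀ y ∈ Pc K, ∀ x ∈ Pf K, ∀ x' ∈ Pf K,
      0 < w K y x → 0 < w K y x' → ‖ΦA K t τ v y x - ΦA K t τ v y x'‖ ≤ ω K)
    (hreprL : ∀ K t, |t| ≤ l₀ → ∀ τ ∈ T K \ Bad K t, ∀ v ∈ Adm,
      f₁ K t τ v (yB K t τ v) = ∑ x ∈ Pf K, e (φB K t τ v x) ∧
        g K t τ v (Q K t τ v (yB K t τ v)) = ∑ y ∈ Pc K, e (ψB K t τ v y))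
    (hΦB : ∀ K t, |t| ≤ l₀ → ∀ τ ∈ T K \ Bad K t, ∀ v ∈ Adm, ∀ y ∈ Pc K, ∀ x ∈ Pf K,
      ‖ΦB K t τ v y x‖ = ‖φB K t τ v x‖)
    (hρB : ∀ K t, |t| ≤ l₀ → ∀ τ ∈ T K \ Bad K t, ∀ v ∈ Adm, ∀ y ∈ Pc K,
      ‖ψB K t τ v y - ∑ x ∈ Pf K, w K y x • ΦB K t τ v y x‖ ≤ ρb K)
    (hsB : ∀ K t, |t| ≤ l₀ → ∀ τ ∈ T K \ Bad K t, ∀ v ∈ Adm, ∀ x ∈ Pf K, ‖φB K t τ v x‖ ≤ s K)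
    (hc₁ : 0 ≤ c₁) (hc₃ : 0 ≤ c₃) (hε₁ : 0 ≤ ε₁)
    (hs : ∀ K, 0 ≤ s K ∧ s K ≤ c₁ * ε₁ * ((L ^ (K + 1))⁻¹) ^ 2)
    (hω : ∀ K, 0 ≤ ω K ∧ ω K ≤ c₂ * ε₁ * ((L ^ (K + 1))⁻¹) ^ 2 * (L ^ K)⁻¹)
    (hρb : ∀ K, 0 ≤ ρb K ∧ ρb K ≤ c₃ * ε₁ ^ 2 * ((L ^ K)⁻¹) ^ 4) :
    (∀ K t, |t| ≤ l₀ → ∀ τ ∈ T K \ Bad K t, ∀ v ∈ Adm,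
      f₁ K t τ v (yA K t τ v) - g K t τ v (xA K t τ v)
        ≤ vol * (n₀ * (c₂ ^ 2 * ε₁ ^ 2 / 4 + c₁ * c₃ * ε₁ ^ 3 + q₄ * (c₁ * ε₁ + c₃ * ε₁ ^ 2) ^ 4)
          * ((L ^ 2)⁻¹) ^ K)) ∧
    (∀ K t, |t| ≤ l₀ → ∀ τ ∈ T K \ Bad K t, ∀ v ∈ Adm,
      g K t τ v (Q K t τ v (yB K t τ v)) - f₁ K t τ v (yB K t τ v)
        ≤ vol * (n₀ * (c₁ * c₃ * ε₁ ^ 3 + c₃ ^ 2 * ε₁ ^ 4 / 2 + q₄ * (c₁ ^ 4 * ε₁ ^ 4)) * ((L ^ 2)⁻¹) ^ K)) ∧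
    (∀ K, 0 ≤ n₀ * (c₂ ^ 2 * ε₁ ^ 2 / 4 + c₁ * c₃ * ε₁ ^ 3 + q₄ * (c₁ * ε₁ + c₃ * ε₁ ^ 2) ^ 4) * ((L ^ 2)⁻¹) ^ K) ∧
    (∀ K, 0 ≤ n₀ * (c₁ * c₃ * ε₁ ^ 3 + c₃ ^ 2 * ε₁ ^ 4 / 2 + q₄ * (c₁ ^ 4 * ε₁ ^ 4)) * ((L ^ 2)⁻¹) ^ K) ∧
    Summable (fun K => n₀ * (c₂ ^ 2 * ε₁ ^ 2 / 4 + c₁ * c₃ * ε₁ ^ 3 + q₄ * (c₁ * ε₁ + c₃ * ε₁ ^ 2) ^ 4)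
      * ((L ^ 2)⁻¹) ^ K) ∧
    Summable (fun K => n₀ * (c₁ * c₃ * ε₁ ^ 3 + c₃ ^ 2 * ε₁ ^ 4 / 2 + q₄ * (c₁ ^ 4 * ε₁ ^ 4)) * ((L ^ 2)⁻¹) ^ K) := by
  have hL0 : 0 < L := by linarith
  have hL2 : (0 : ℝ) ≤ L ^ 2 := by positivity
  have hrc : L ^ 2 * (L ^ 2)⁻¹ = 1 := mul_inv_cancel₀ (pow_ne_zero 2 hL0.ne')
  have hU := geometricRate_nonneg_summable hL
    (show 0 ≤ n₀ * (c₂ ^ 2 * ε₁ ^ 2 / 4 + c₁ * c₃ * ε₁ ^ 3 + q₄ * (c₁ * ε₁ + c₃ * ε₁ ^ 2) ^ 4) by positivity)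
  have hLs := geometricRate_nonneg_summable hL
    (show 0 ≤ n₀ * (c₁ * c₃ * ε₁ ^ 3 + c₃ ^ 2 * ε₁ ^ 4 / 2 + q₄ * (c₁ ^ 4 * ε₁ ^ 4)) by positivity)
  refine ⟨fun K t ht τ hτ v hv => ?_, fun K t ht τ hτ v hv => ?_, hU.1, hLs.1, hU.2, hLs.2⟩
  · obtain ⟨ha0, ha1, hb0, hba, hrb, hξ⟩ := scale_facts hL K
    obtain ⟨e1, e2⟩ := hreprU K t ht τ hτ v hv
    have key := interpolationError_le_of_sizes (Pf K) (Pc K) he hq₄ (hw K) hL2 (hrow K) (hcol K) hrc.symm.le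
      (hΦA K t ht τ hτ v hv) (hs K).1 (hsA K t ht τ hτ v hv) (hoscA K t ht τ hτ v hv) (hρb K).1
      (hρA K t ht τ hτ v hv) le_rfl
    have sc := interpolationSize_le_scale hq₄ hL2 hn₀ hvol hc₁ hc₃ hε₁ ha0 ha1 hrb (hs K).1 (hs K).2 (hω K).1
      (hω K).2 (hρb K).1 (hρb K).2 (Nat.cast_nonneg _) (count_mul_inv_pow_le (pow_pos hL0 K) (hNc K))
    rw [e1, e2, ← hξ]
    exact key.trans sc
  · obtain ⟨ha0, ha1, hb0, hba, hrb, hξ⟩ := scale_facts hL K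
    obtain ⟨e1, e2⟩ := hreprL K t ht τ hτ v hv
    have key := averagingError_le_of_sizes (Pf K) (Pc K) he hq₄ (hw K) hL2 (fun y hy => (hrow K y hy).le)
      (fun x hx => (hcol K x hx).le) hrc.le (hΦB K t ht τ hτ v hv) (hs K).1 (hsB K t ht τ hτ v hv) (hρb K).1
      (hρB K t ht τ hτ v hv) le_rfl le_rfl
    have sc := averagingSize_le_scale hq₄ hL2 hn₀ hvol hc₁ hc₃ hε₁ ha0 ha1 hb0 hba hrb (hs K).1 (hs K).2
      (hρb K).1 (hρb K).2 (Nat.cast_nonneg _) (count_mul_inv_pow_le (pow_pos hL0 (K + 1)) (hNf K))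
      (Nat.cast_nonneg _) (count_mul_inv_pow_le (pow_pos hL0 K) (hNc K))
    rw [e1, e2, ← hξ]
    exact key.trans sc

end Indexed

section Ledger

variable {C : T4BoundaryCarrier.Carriers} {ι : Type} [MeasurableSpace ι] {σ : Type*} [DecidableEq σ] {l₀ vol : ℝ}
  {T : ℕ → Finset σ} {Bad : ℕ → ℝ → Finset σ} {A B : ℕ → ℝ → σ → ℝ} {μ : ℕ → ℝ → σ → Measure ι}
  {fac bfac rfac : ℕ → ℝ → σ → Finset C.Dom} {Adm : Set ι} {EA : Functional C.toCarriers C.BgA}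
  {EB : Functional C.toCarriers C.BgB} {BA : BFunctional C C.BgA} {BB : BFunctional C C.BgB}
  {RA : Functional C.toCarriers C.BgA} {RB : Functional C.toCarriers C.BgB}
  {κ θ' Cr EB₀ CrR R₁ b β' w₀ : ℝ} {κ₀ : ℕ} {gA gB : ℕ → ℕ → ℝ} {gfA gfB : ℕ → ℝ} {gsA gsB : ℕ → ℕ → ℝ}
  {uA : ℕ → ι → C.BgA} {uB : ℕ → ι → C.BgB} {oneA : C.BgA} {oneB : C.BgB}
  {pend : ℕ → ℝ → σ → ι → C.Fl} {nA nB aA aB wA wB γA γB : ℕ → ℝ → σ → ι → ℝ} {qA qB : ℕ → ℝ}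
  {κ₁ S : ℕ → ℝ → σ → ℕ → ℝ} {cW RW : ℕ → ℝ → σ → ℝ} {rw sw dU dL rγ zA zB c₀ : ℕ → ℝ} {Cw E a Λ Cl : ℝ}
  {V : Type*} [NormedAddCommGroup V] [InnerProductSpace ℝ V] {Xf Xc : Type*}

/-- **THE GOOD-CLASS HALF WITH `Summable δ⁗`, (U)(L) PRODUCED FROM THE REGULARITY OF ONE STEP.**  Generation 9's
`goodClause_summable_of_kindsRA_lift` (all its binders BY NAME and VERBATIM: composed E-rate `hUR`, boundary rate family
`hURB`, 𝐑-rate family `hURR`, format (F), sizes (S), multiplicities (M)(M-B)(M-R), witness (F′), (B-adm)(B-win),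
one-sided sizes (N), constants (Q), 𝐑-slice sizes (R-S), the flow window (0.31) of both coupling tables, (min-A)(Q)(lift)
(min-B)(act)(γ)(R-w)(W-w)), with (U) `hUdev hdU0 hdU` and (L) `hLdev hdL0 hdL` REPLACED by the binders of §5's
`interpolation_averaging_of_regular`: (wt)(ker)(cnt)(repr-U)(tr-U)(bch-U)(sz-U)(osc-U)(repr-L)(tr-L)(bch-L)(sz-L)(scal).
OUTPUT: the good clause with generation 9's `δ⁗` in which `dU_K + dL_K` is now the EXPLICIT geometric majorant
`n₀·(c₂²ε₁²/4 + c₁c₃ε₁³ + q₄(c₁ε₁ + c₃ε₁²)⁴)·(L⁻²)^K + n₀·(c₁c₃ε₁³ + c₃²ε₁⁴/2 + q₄c₁⁴ε₁⁴)·(L⁻²)^K`, and its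
summability. [folklore] -/
theorem goodClause_summable_of_kindsRA_regular {Y YA : Type*} {Sfib : ℕ → ℝ → σ → ι → Set Y}
    {SfibA : ℕ → ℝ → σ → ι → Set YA} {g : ℕ → ℝ → σ → ι → YA → ℝ} {f₁ : ℕ → ℝ → σ → ι → Y → ℝ}
    {Q : ℕ → ℝ → σ → ι → Y → YA} {yA yB : ℕ → ℝ → σ → ι → Y} {xA : ℕ → ℝ → σ → ι → YA}
    {Pf : ℕ → Finset Xf} {Pc : ℕ → Finset Xc} {w : ℕ → Xc → Xf → ℝ} {e : V → ℝ}
    {φA φB : ℕ → ℝ → σ → ι → Xf → V} {ψA ψB : ℕ → ℝ → σ → ι → Xc → V} {ΦA ΦB : ℕ → ℝ → σ → ι → Xc → Xf → V}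
    {q₄ L n₀ c₁ c₂ c₃ ε₁ : ℝ} {s ω ρb : ℕ → ℝ}
    (hUR : ∀ K, URateUpTo K EA EB (gA K) (gB K) (uA K) (uB K) Adm Cr θ' κ) (hCr : 0 ≤ Cr)
    (hθ'0 : 0 < θ') (hθ'1 : θ' < 1) (hθ'Λ : θ' ≤ Λ) (hΛ1 : 1 ≤ Λ) (hCl : 0 ≤ Cl)
    (hURB : ∀ b ∈ C.admFl, ∀ K, URateUpTo K (atFl BA b) (atFl BB b) (gA K) (gB K) (uA K) (uB K) Adm EB₀ θ' κ)
    (hEB₀ : 0 ≤ EB₀)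
    (hURR : ∀ K, URateUpTo K RA RB (gA K) (gB K) (uA K) (uB K) Adm CrR θ' κ) (hCrR : 0 ≤ CrR)
    (hfmtA : ∀ K t τ, A K t τ = ∫ v, (∏ X ∈ fac K t τ,
      Real.exp (EA (gA K) (uA K v) X - EA (gA K) oneA X)) *
        ((∏ X ∈ bfac K t τ, Real.exp (BA (gA K) (uA K v) (pend K t τ v) X)) * nA K t τ v * qA K *
          ((∏ X ∈ rfac K t τ, Real.exp (RA (gA K) (uA K v) X - RA (gA K) oneA X)) * (Real.exp (-aA K t τ v) * wA K t τ v)))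
          ∂(μ K t τ))
    (hfmtB : ∀ K t τ, B K t τ = ∫ v, (∏ X ∈ fac K t τ,
      Real.exp (EB (gB K) (uB K v) X - EB (gB K) oneB X)) *
        ((∏ X ∈ bfac K t τ, Real.exp (BB (gB K) (uB K v) (pend K t τ v) X)) * nB K t τ v * qB K *
          ((∏ X ∈ rfac K t τ, Real.exp (RB (gB K) (uB K v) X - RB (gB K) oneB X)) * (Real.exp (-aB K t τ v) * wB K t τ v)))
          ∂(μ K t τ))
    (hint : ∀ K t, |t| ≤ l₀ → ∀ τ ∈ T K \ Bad K t,
      Integrable (fun v => (∏ X ∈ fac K t τ, Real.exp (EA (gA K) (uA K v) X - EA (gA K) oneA X)) *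
        ((∏ X ∈ bfac K t τ, Real.exp (BA (gA K) (uA K v) (pend K t τ v) X)) * nA K t τ v * qA K *
          ((∏ X ∈ rfac K t τ, Real.exp (RA (gA K) (uA K v) X - RA (gA K) oneA X)) * (Real.exp (-aA K t τ v) * wA K t τ v))))
          (μ K t τ) ∧
      Integrable (fun v => (∏ X ∈ fac K t τ, Real.exp (EB (gB K) (uB K v) X - EB (gB K) oneB X)) *
        ((∏ X ∈ bfac K t τ, Real.exp (BB (gB K) (uB K v) (pend K t τ v) X)) * nB K t τ v * qB K *
          ((∏ X ∈ rfac K t τ, Real.exp (RB (gB K) (uB K v) X - RB (gB K) oneB X)) * (Real.exp (-aB K t τ v) * wB K t τ v))))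
          (μ K t τ))
    (hsc : ∀ K t, |t| ≤ l₀ → ∀ τ ∈ T K \ Bad K t, ∀ X ∈ fac K t τ, C.scale X ≤ K)
    (hoff : ∀ K t, |t| ≤ l₀ → ∀ τ ∈ T K \ Bad K t, ∀ v, v ∉ Adm →
      (∏ X ∈ fac K t τ, Real.exp (EA (gA K) (uA K v) X - EA (gA K) oneA X)) *
        ((∏ X ∈ bfac K t τ, Real.exp (BA (gA K) (uA K v) (pend K t τ v) X)) * nA K t τ v * qA K *
          ((∏ X ∈ rfac K t τ, Real.exp (RA (gA K) (uA K v) X - RA (gA K) oneA X)) * (Real.exp (-aA K t τ v) * wA K t τ v)))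
          = 0 ∧
      (∏ X ∈ fac K t τ, Real.exp (EB (gB K) (uB K v) X - EB (gB K) oneB X)) *
        ((∏ X ∈ bfac K t τ, Real.exp (BB (gB K) (uB K v) (pend K t τ v) X)) * nB K t τ v * qB K *
          ((∏ X ∈ rfac K t τ, Real.exp (RB (gB K) (uB K v) X - RB (gB K) oneB X)) * (Real.exp (-aB K t τ v) * wB K t τ v)))
          = 0)
    (hS : ∀ K t, |t| ≤ l₀ → ∀ τ ∈ T K \ Bad K t, ∀ v ∈ Adm, ∀ j ≤ K,
      |(∑ X ∈ fac K t τ with C.scale X = j,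
          (Real.log (Real.exp (EB (gB K) (uB K v) X - EB (gB K) oneB X))
            - Real.log (Real.exp (EA (gA K) (uA K v) X - EA (gA K) oneA X)))) - κ₁ K t τ j| ≤ S K t τ j)
    (hM : ∀ K t, |t| ≤ l₀ → ∀ τ ∈ T K \ Bad K t,
      Multiplicity (fac K t τ) C.scale (fun X => Real.exp (-(κ * C.d X))) Cw vol Λ K)
    (hwit : ∀ K, ∃ v₁ ∈ Adm, uA K v₁ = oneA ∧ uB K v₁ = oneB)
    (hvol : 0 ≤ vol) (hE : 0 ≤ E) (ha0 : 0 < a) (ha1 : a < 1)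
    (hSle : ∀ K t, |t| ≤ l₀ → ∀ τ ∈ T K \ Bad K t, ∀ j ≤ K, S K t τ j ≤ vol * (E * a ^ (K - j)))
    (hpend : ∀ K t, |t| ≤ l₀ → ∀ τ ∈ T K \ Bad K t, ∀ v ∈ Adm, pend K t τ v ∈ C.admFl)
    (hBwin : ∀ K t, |t| ≤ l₀ → ∀ τ ∈ T K \ Bad K t, RecentOnly (bfac K t τ) C.scale (jlogOf Cl K) K)
    (hMB : ∀ K t, |t| ≤ l₀ → ∀ τ ∈ T K \ Bad K t,
      Multiplicity (bfac K t τ) C.scale (fun X => Real.exp (-(κ * C.d X))) Cw vol Λ K)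
    (hnpos : ∀ K t, |t| ≤ l₀ → ∀ τ ∈ T K \ Bad K t, ∀ v ∈ Adm, 0 < nA K t τ v ∧ 0 < nB K t τ v)
    (hzA : ∀ K t, |t| ≤ l₀ → ∀ τ ∈ T K \ Bad K t, ∀ v ∈ Adm, |Real.log (nA K t τ v)| ≤ vol * zA K)
    (hzB : ∀ K t, |t| ≤ l₀ → ∀ τ ∈ T K \ Bad K t, ∀ v ∈ Adm, |Real.log (nB K t τ v)| ≤ vol * zB K)
    (hzAs : Summable zA) (hzBs : Summable zB)
    (hq : ∀ K, 0 < qA K ∧ 0 < qB K)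
    -- the 𝐑-kind: scales, multiplicity, one-run slice sizes, the flow window of both coupling tables
    (hrsc : ∀ K t, |t| ≤ l₀ → ∀ τ ∈ T K \ Bad K t, ∀ X ∈ rfac K t τ, C.scale X ≤ K)
    (hMR : ∀ K t, |t| ≤ l₀ → ∀ τ ∈ T K \ Bad K t,
      Multiplicity (rfac K t τ) C.scale (fun X => Real.exp (-(κ * C.d X))) Cw vol Λ K)
    (hRSA : ∀ K t, |t| ≤ l₀ → ∀ τ ∈ T K \ Bad K t, ∀ v ∈ Adm, ∀ j ≤ K,
      |∑ X ∈ rfac K t τ with C.scale X = j, (RA (gA K) (uA K v) X - RA (gA K) oneA X)| ≤ vol * (R₁ * gsA K j ^ κ₀))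
    (hRSB : ∀ K t, |t| ≤ l₀ → ∀ τ ∈ T K \ Bad K t, ∀ v ∈ Adm, ∀ j ≤ K,
      |∑ X ∈ rfac K t τ with C.scale X = j, (RB (gB K) (uB K v) X - RB (gB K) oneB X)| ≤ vol * (R₁ * gsB K j ^ κ₀))
    (hb : 0 < b) (h031A : ∀ K, Step.Discrete031 b β' K (gfA K) (gsA K))
    (h031B : ∀ K, Step.Discrete031 b β' K (gfB K) (gsB K)) (hgsA : ∀ K k, k ≤ K → 0 ≤ gsA K k)
    (hgsB : ∀ K k, k ≤ K → 0 ≤ gsB K k) (hR₁ : 0 ≤ R₁) (hκ₀ : 4 < κ₀)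
    -- the ACTION kind from ONE CLASSICAL STEP: (min-A) (Q) (lift) (min-B) (act) (U) (L) (γ)
    (hminA : ∀ K t, |t| ≤ l₀ → ∀ τ ∈ T K \ Bad K t, ∀ v ∈ Adm, IsMinOn (g K t τ v) (SfibA K t τ v) (xA K t τ v))
    (hQ : ∀ K t, |t| ≤ l₀ → ∀ τ ∈ T K \ Bad K t, ∀ v ∈ Adm, Set.MapsTo (Q K t τ v) (Sfib K t τ v) (SfibA K t τ v))
    (hlift : ∀ K t, |t| ≤ l₀ → ∀ τ ∈ T K \ Bad K t, ∀ v ∈ Adm,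
      yA K t τ v ∈ Sfib K t τ v ∧ Q K t τ v (yA K t τ v) = xA K t τ v)
    (hminB : ∀ K t, |t| ≤ l₀ → ∀ τ ∈ T K \ Bad K t, ∀ v ∈ Adm,
      yB K t τ v ∈ Sfib K t τ v ∧ IsMinOn (f₁ K t τ v) (Sfib K t τ v) (yB K t τ v))
    (hact : ∀ K t, |t| ≤ l₀ → ∀ τ ∈ T K \ Bad K t, ∀ v ∈ Adm,
      aA K t τ v = w₀ * g K t τ v (xA K t τ v) + γA K t τ v ∧
        aB K t τ v = w₀ * f₁ K t τ v (yB K t τ v) + γB K t τ v)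
    (hw₀ : 0 ≤ w₀)
    -- (U)(L) PRODUCED (§5 `interpolation_averaging_of_regular`): (wt)(ker)(cnt)(repr-U)(tr-U)(bch-U)(sz-U)(osc-U)
    -- (repr-L)(tr-L)(bch-L)(sz-L)(scal) in place of generation 9's `hUdev hLdev hdU0 hdL0 hdU hdL`
    (he : ∀ v, ‖v‖ ^ 2 / 2 - q₄ * ‖v‖ ^ 4 ≤ e v ∧ e v ≤ ‖v‖ ^ 2 / 2) (hq₄ : 0 ≤ q₄) (hL : 1 < L)
    (hw : ∀ K, ∀ y ∈ Pc K, ∀ x ∈ Pf K, 0 ≤ w K y x) (hrow : ∀ K, ∀ y ∈ Pc K, ∑ x ∈ Pf K, w K y x = L ^ 2)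
    (hcol : ∀ K, ∀ x ∈ Pf K, ∑ y ∈ Pc K, w K y x = (L ^ 2)⁻¹) (hn₀ : 0 ≤ n₀)
    (hNf : ∀ K, ((Pf K).card : ℝ) ≤ n₀ * vol * (L ^ (K + 1)) ^ 4)
    (hNc : ∀ K, ((Pc K).card : ℝ) ≤ n₀ * vol * (L ^ K) ^ 4)
    (hreprU : ∀ K t, |t| ≤ l₀ → ∀ τ ∈ T K \ Bad K t, ∀ v ∈ Adm,
      f₁ K t τ v (yA K t τ v) = ∑ x ∈ Pf K, e (φA K t τ v x) ∧
        g K t τ v (xA K t τ v) = ∑ y ∈ Pc K, e (ψA K t τ v y))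
    (hΦA : ∀ K t, |t| ≤ l₀ → ∀ τ ∈ T K \ Bad K t, ∀ v ∈ Adm, ∀ y ∈ Pc K, ∀ x ∈ Pf K,
      ‖ΦA K t τ v y x‖ = ‖φA K t τ v x‖)
    (hρA : ∀ K t, |t| ≤ l₀ → ∀ τ ∈ T K \ Bad K t, ∀ v ∈ Adm, ∀ y ∈ Pc K,
      ‖ψA K t τ v y - ∑ x ∈ Pf K, w K y x • ΦA K t τ v y x‖ ≤ ρb K)
    (hsA : ∀ K t, |t| ≤ l₀ → ∀ τ ∈ T K \ Bad K t, ∀ v ∈ Adm, ∀ x ∈ Pf K, ‖φA K t τ v x‖ ≤ s K)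
    (hoscA : ∀ K t, |t| ≤ l₀ → ∀ τ ∈ T K \ Bad K t, ∀ v ∈ Adm, ∀ y ∈ Pc K, ∀ x ∈ Pf K, ∀ x' ∈ Pf K,
      0 < w K y x → 0 < w K y x' → ‖ΦA K t τ v y x - ΦA K t τ v y x'‖ ≤ ω K)
    (hreprL : ∀ K t, |t| ≤ l₀ → ∀ τ ∈ T K \ Bad K t, ∀ v ∈ Adm,
      f₁ K t τ v (yB K t τ v) = ∑ x ∈ Pf K, e (φB K t τ v x) ∧
        g K t τ v (Q K t τ v (yB K t τ v)) = ∑ y ∈ Pc K, e (ψB K t τ v y))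
    (hΦB : ∀ K t, |t| ≤ l₀ → ∀ τ ∈ T K \ Bad K t, ∀ v ∈ Adm, ∀ y ∈ Pc K, ∀ x ∈ Pf K,
      ‖ΦB K t τ v y x‖ = ‖φB K t τ v x‖)
    (hρB : ∀ K t, |t| ≤ l₀ → ∀ τ ∈ T K \ Bad K t, ∀ v ∈ Adm, ∀ y ∈ Pc K,
      ‖ψB K t τ v y - ∑ x ∈ Pf K, w K y x • ΦB K t τ v y x‖ ≤ ρb K)
    (hsB : ∀ K t, |t| ≤ l₀ → ∀ τ ∈ T K \ Bad K t, ∀ v ∈ Adm, ∀ x ∈ Pf K, ‖φB K t τ v x‖ ≤ s K)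
    (hc₁ : 0 ≤ c₁) (hc₃ : 0 ≤ c₃) (hε₁ : 0 ≤ ε₁)
    (hs : ∀ K, 0 ≤ s K ∧ s K ≤ c₁ * ε₁ * ((L ^ (K + 1))⁻¹) ^ 2)
    (hω : ∀ K, 0 ≤ ω K ∧ ω K ≤ c₂ * ε₁ * ((L ^ (K + 1))⁻¹) ^ 2 * (L ^ K)⁻¹)
    (hρb : ∀ K, 0 ≤ ρb K ∧ ρb K ≤ c₃ * ε₁ ^ 2 * ((L ^ K)⁻¹) ^ 4)
    (hγ : ∀ K t, |t| ≤ l₀ → ∀ τ ∈ T K \ Bad K t, ∀ v ∈ Adm, |γB K t τ v - γA K t τ v| ≤ vol * rγ K)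
    (hrγ : Summable rγ)
    -- the residual kind after generation 8: (R-w) radii about a centre `cW`, (W-w) the WITNESS log-ratio centred
    (hwpos : ∀ K t, |t| ≤ l₀ → ∀ τ ∈ T K \ Bad K t, ∀ v ∈ Adm, 0 < wA K t τ v ∧ 0 < wB K t τ v)
    (hRw : ∀ K t, |t| ≤ l₀ → ∀ τ ∈ T K \ Bad K t, ∀ v ∈ Adm,
      |Real.log (wB K t τ v) - Real.log (wA K t τ v) - cW K t τ| ≤ RW K t τ)
    (hRRw : ∀ K t, |t| ≤ l₀ → ∀ τ ∈ T K \ Bad K t, RW K t τ ≤ vol * rw K) (hrw : Summable rw)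
    (hWw : ∀ K t, |t| ≤ l₀ → ∀ τ ∈ T K \ Bad K t, ∀ v ∈ Adm, uA K v = oneA → uB K v = oneB →
      |Real.log (wB K t τ v) - Real.log (wA K t τ v) - c₀ K| ≤ vol * sw K)
    (hsw : Summable sw) :
    GoodClause l₀ vol T A B Bad
        (fun K => (max Cw 1 * ((E + Cr) * ∑ x ∈ antidiagonal K, min (a ^ x.2) (θ' ^ x.1 * Λ ^ x.2))
            + (EB₀ * Cw * windowSum θ' Λ (jlogOf Cl K) K + (zA K + zB K)
              + (max (2 * Cw) 1 * ((∑ p ∈ antidiagonal K, min (R₁ * gsA K p.1 ^ κ₀) (CrR * θ' ^ p.1 * Λ ^ p.2))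
                  + ∑ p ∈ antidiagonal K, min (R₁ * gsB K p.1 ^ κ₀) (CrR * θ' ^ p.1 * Λ ^ p.2))
                + (w₀ * (n₀ * (c₂ ^ 2 * ε₁ ^ 2 / 4 + c₁ * c₃ * ε₁ ^ 3 + q₄ * (c₁ * ε₁ + c₃ * ε₁ ^ 2) ^ 4)
                    * ((L ^ 2)⁻¹) ^ K
                  + n₀ * (c₁ * c₃ * ε₁ ^ 3 + c₃ ^ 2 * ε₁ ^ 4 / 2 + q₄ * (c₁ ^ 4 * ε₁ ^ 4)) * ((L ^ 2)⁻¹) ^ K)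
                  + rγ K + rw K))))
          + (max Cw 1 * ((E + Cr) * ∑ x ∈ antidiagonal K, min (a ^ x.2) (θ' ^ x.1 * Λ ^ x.2)) + (rw K + sw K))) ∧
      Summable (fun K => (max Cw 1 * ((E + Cr) * ∑ x ∈ antidiagonal K, min (a ^ x.2) (θ' ^ x.1 * Λ ^ x.2))
            + (EB₀ * Cw * windowSum θ' Λ (jlogOf Cl K) K + (zA K + zB K)
              + (max (2 * Cw) 1 * ((∑ p ∈ antidiagonal K, min (R₁ * gsA K p.1 ^ κ₀) (CrR * θ' ^ p.1 * Λ ^ p.2))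
                  + ∑ p ∈ antidiagonal K, min (R₁ * gsB K p.1 ^ κ₀) (CrR * θ' ^ p.1 * Λ ^ p.2))
                + (w₀ * (n₀ * (c₂ ^ 2 * ε₁ ^ 2 / 4 + c₁ * c₃ * ε₁ ^ 3 + q₄ * (c₁ * ε₁ + c₃ * ε₁ ^ 2) ^ 4)
                    * ((L ^ 2)⁻¹) ^ K
                  + n₀ * (c₁ * c₃ * ε₁ ^ 3 + c₃ ^ 2 * ε₁ ^ 4 / 2 + q₄ * (c₁ ^ 4 * ε₁ ^ 4)) * ((L ^ 2)⁻¹) ^ K)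
                  + rγ K + rw K))))
          + (max Cw 1 * ((E + Cr) * ∑ x ∈ antidiagonal K, min (a ^ x.2) (θ' ^ x.1 * Λ ^ x.2)) + (rw K + sw K))) := by
  obtain ⟨hUdev, hLdev, hdU0, hdL0, hdU, hdL⟩ := interpolation_averaging_of_regular he hq₄ hL hw hrow hcol hn₀ hvol
    hNf hNc hreprU hΦA hρA hsA hoscA hreprL hΦB hρB hsB hc₁ hc₃ hε₁ hs hω hρb
  exact goodClause_summable_of_kindsRA_lift hUR hCr hθ'0 hθ'1 hθ'Λ hΛ1 hCl hURB hEB₀ hURR hCrR hfmtA hfmtB hint hsc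
    hoff hS hM hwit hvol hE ha0 ha1 hSle hpend hBwin hMB hnpos hzA hzB hzAs hzBs hq hrsc hMR hRSA hRSB hb h031A h031B
    hgsA hgsB hR₁ hκ₀ hminA hQ hlift hminB hact hw₀ hUdev hLdev hdU0 hdL0 hdU hdL hγ hrγ hwpos hRw hRRw hrw hWw hsw

end Ledger

/-! ## §6 Sanity: the weight binder inhabited by the Wilson weight, and the BCH cross term of (L) attained -/

section Toy

/-- (wt) INHABITED BY THE WILSON WEIGHT OF U(1), NON-QUADRATICALLY.  On `V = ℝ` (abelian plaquette angles) the weight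
`e(x) = 1 − cos x` satisfies the quartic sandwich with `q₄ = 1/24` (§1), and it is NOT its quadratic part: at `x = π`,
`1 − cos π = 2 ≠ π²/2`. [folklore] -/
theorem toy_wilsonWeight :
    (∀ x : ℝ, ‖x‖ ^ 2 / 2 - 1 / 24 * ‖x‖ ^ 4 ≤ 1 - Real.cos x ∧ 1 - Real.cos x ≤ ‖x‖ ^ 2 / 2) ∧
      1 - Real.cos Real.pi ≠ ‖Real.pi‖ ^ 2 / 2 := by
  refine ⟨one_sub_cos_sandwich_norm, ?_⟩
  rw [Real.cos_pi, Real.norm_eq_abs, abs_of_pos Real.pi_pos]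
  nlinarith [Real.pi_gt_three]

/-- THE BCH CROSS TERM OF (L) IS ATTAINED.  One fine and one coarse plaquette (`Unit`), weight `w = 1` (`r = c = 1`),
quadratic weight `e(v) = ‖v‖²/2` (`q₄ = 0`), fine field `φ = 1` transported trivially (`Φ = 1`), coarse field `ψ = 2` =
the average `1` plus a BCH remainder of size EXACTLY `ρ = 1`: the averaging error (L) is `3/2 ≠ 0` and EQUALS the
bound of `averagingError_le`, `(rc − 1)/2·Σ‖φ‖² + Σ_y (‖Σ_x w•Φ‖·ρ + ρ²/2) + q₄·Σ‖φ‖⁴ = 0 + (1·1 + 1/2) + 0`.  No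
physics. [folklore] -/
theorem toy_bchCrossTerm_attained :
    let w : Unit → Unit → ℝ := fun _ _ => 1
    let φ : Unit → ℝ := fun _ => 1
    let Φ : Unit → Unit → ℝ := fun _ _ => 1
    let ψ : Unit → ℝ := fun _ => 2
    let e : ℝ → ℝ := fun v => ‖v‖ ^ 2 / 2
    let ρ : Unit → ℝ := fun _ => 1
    (∀ v : ℝ, ‖v‖ ^ 2 / 2 - 0 * ‖v‖ ^ 4 ≤ e v ∧ e v ≤ ‖v‖ ^ 2 / 2) ∧
      (∀ y ∈ (Finset.univ : Finset Unit), ‖ψ y - ∑ x ∈ (Finset.univ : Finset Unit), w y x • Φ y x‖ ≤ ρ y) ∧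
      ∑ y ∈ (Finset.univ : Finset Unit), e (ψ y) - ∑ x ∈ (Finset.univ : Finset Unit), e (φ x) = 3 / 2 ∧
      (1 * 1 - 1) / 2 * ∑ x ∈ (Finset.univ : Finset Unit), ‖φ x‖ ^ 2
          + ∑ y ∈ (Finset.univ : Finset Unit),
              (‖∑ x ∈ (Finset.univ : Finset Unit), w y x • Φ y x‖ * ρ y + ρ y ^ 2 / 2)
          + 0 * ∑ x ∈ (Finset.univ : Finset Unit), ‖φ x‖ ^ 4 = 3 / 2 := by
  intro w φ Φ ψ e ρ
  refine ⟨fun v => ⟨by simp [e], by simp [e]⟩, fun y _ => ?_, ?_, ?_⟩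
  · norm_num [ψ, w, Φ, ρ]
  · norm_num [e, ψ, φ]
  · norm_num [w, Φ, φ, ρ]

end Toy

end Literature.MathematicalPhysics.QuantumFieldTheory.Balaban1983to89.T4TermwiseQuartic
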